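import Literature.Analysis.FluidPDE.PassiveVectorTensorDistorted
import Literature.Analysis.FluidPDE.PassiveVectorTensorDuality
import Literature.Analysis.FunctionSpaces.DuBoisReymondAE
import Mathlib.MeasureTheory.Integral.IntervalIntegral.AbsolutelyContinuousFun
import HarnessLib

/-!
# The flat weak formulation for TIME-LIPSCHITZ, space-smooth test fields

Analysis/FluidPDE proof-support file (everything proved; no definitions, no named facts). The weak
class `Torus.IsWeakTensorPassiveVectorOn A T 𝔸 b w₀ w` (`∂ₜw + (b·∇)w + A (w·∇)b + ∇π = 𝓛_𝔸 w`,
`∇·w = 0`) tests against jointly `C^∞` fields (`IsSpaceTimeTest`). Lagrangian conjugation by a flow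
that is only Lipschitz in time produces tests that are smooth in space but merely LIPSCHITZ in time
(`Torus.IsLipschitzSpaceTimeTest`, `PassiveVectorTensorDistorted`); this file extends the weak
formulation to them (the "straightforward mollification in time" of the literature, done here
WITHOUT mollifiers, mode by mode):

* §1 one-dimensional integration by parts against a Lipschitz test
  (`setIntegral_mul_deriv_add_mul_eq_neg`): if `U = c + ∫₀ᵗ F` a.e. on `(0,T)` (`F ∈ L¹`) and `η` is
  Lipschitz on `[0,T]` with `η = 0` on `[T', ∞)`, `T' < T`, then `∫₀ᵀ (U η' + F η) = −c η(0)`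
  (Fubini on the triangle + the fundamental theorem of calculus for absolutely continuous functions,
  Brezis Cor. 8.10);
* §2 uniform-in-time truncation errors of time-Lipschitz space-smooth tests: `P_N Ψ(t) → Ψ(t)` with
  all space derivatives, uniformly on `[0,T] × T^d` (Robinson–Rodrigo–Sadowski 2016, Thm. 4.4 Step 4);
* §3–§4 the per-mode identity and its sum over the Fourier ball, §5 the limit `N → ∞`:
  **`IsWeakTensorPassiveVectorOn.weak_eq_of_isLipschitzSpaceTimeTest`** — for `w₀ ∈ L²` and a
  time-Lipschitz space-smooth divergence-free `Ψ` vanishing near `T`,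
  `∫₀ᵀ∫ (⟪w, ∂ₜΨ + (b·∇)Ψ + 𝓛_𝔸^*Ψ⟫ + A⟪b, (w·∇)Ψ⟫) + ∫⟪w₀, Ψ(0)⟫ = 0`,
  and the converse bridge `IsWeakTensorPassiveVectorOn.toDistorted_one` to the distorted class with
  `G ≡ 1`.

Consumer: S1′ of the K1L one-level split (conjugation of flat solutions by the Lagrangian flow;
route `SolenoidalFractalHomogenisation`, cell `ad-ideate`, tenure D24-7).

## References

* H. Brezis, *Functional Analysis, Sobolev Spaces and PDE* (Springer 2011), Cor. 8.10 (integration by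
  parts in `W^{1,p}(I)`), Lemma 8.1–8.2. [`Brezis2011`]
* J. C. Robinson, J. L. Rodrigo, W. Sadowski, *The three-dimensional Navier–Stokes equations* (CUP 2016),
  §4.1 and Thm. 4.4 Step 4 (`P_N ψ → ψ` uniformly). [`RobinsonRodrigoSadowski2016`]
* R. J. DiPerna, P.-L. Lions, Invent. Math. 98 (1989), §II.1 (12)–(14). [`DiPernaLions1989`]
-/

noncomputable section

open MeasureTheory Set Filter Function TopologicalSpace Complex UnitAddTorus
open scoped ENNReal NNReal InnerProductSpace Topology ComplexConjugate ContDiff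

namespace Literature.Analysis.FluidPDE

namespace Torus

variable {d : Type*} [Fintype d] [DecidableEq d]

/-! ## §1 One-dimensional integration by parts against a Lipschitz test -/

section OneDim

omit [Fintype d] [DecidableEq d]

variable {F' : Type*} [NormedAddCommGroup F'] [NormedSpace ℝ F']

/-- A function Lipschitz on `[0,T]` (constant `L ≥ 0`, uniformly) has `‖deriv η t‖ ≤ L` at every
`t ∈ (0,T)` (slopes are bounded by `L` near `t`; at points of non-differentiability `deriv = 0`).
[cite: Brezis2011, Cor. 8.10 (W^{1,∞} = Lip)] -/
theorem norm_deriv_le_of_lipschitzOn {η : ℝ → F'} {T L : ℝ} (hL0 : 0 ≤ L)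
    (hL : ∀ t ∈ Icc 0 T, ∀ s ∈ Icc 0 T, ‖η t - η s‖ ≤ L * |t - s|) {t : ℝ} (ht : t ∈ Ioo 0 T) :
    ‖deriv η t‖ ≤ L := by
  by_cases hd : DifferentiableAt ℝ η t
  · have hder := hd.hasDerivAt
    rw [hasDerivAt_iff_tendsto_slope] at hder
    have hev : ∀ᶠ s in 𝓝[≠] t, ‖slope η t s‖ ≤ L := by
      have hmem : ∀ᶠ s in 𝓝[≠] t, s ∈ Ioo 0 T := mem_nhdsWithin_of_mem_nhds (Ioo_mem_nhds ht.1 ht.2)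
      filter_upwards [hmem, self_mem_nhdsWithin] with s hs hst
      rw [slope_def_module, norm_smul, norm_inv, Real.norm_eq_abs]
      have hts : 0 < |s - t| := abs_pos.2 (sub_ne_zero.2 hst)
      have h1 := hL s (Ioo_subset_Icc_self hs) t (Ioo_subset_Icc_self ht)
      calc |s - t|⁻¹ * ‖η s - η t‖ ≤ |s - t|⁻¹ * (L * |s - t|) :=
            mul_le_mul_of_nonneg_left h1 (inv_nonneg.2 hts.le)
        _ = L := by field_simp
    have hlim := (continuous_norm.tendsto _).comp hder
    rw [hd.hasDerivAt.deriv]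
    exact le_of_tendsto hlim hev
  · rw [deriv_zero_of_not_differentiableAt hd, norm_zero]
    exact hL0

/-- **Fundamental theorem of calculus for a real function Lipschitz on `[0,T]`**:
`∫ₐᵇ deriv η = η b − η a` for `0 ≤ a ≤ b ≤ T` (Lipschitz ⇒ absolutely continuous).
[cite: Brezis2011, Cor. 8.10 (W^{1,∞} = Lip)] -/
theorem intervalIntegral_deriv_eq_sub_of_lipschitzOn {η : ℝ → ℝ} {T L : ℝ}
    (hL : ∀ t ∈ Icc 0 T, ∀ s ∈ Icc 0 T, ‖η t - η s‖ ≤ L * |t - s|) {a b : ℝ} (ha : 0 ≤ a)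
    (hab : a ≤ b) (hb : b ≤ T) :
    ∫ t in a..b, deriv η t = η b - η a := by
  have hlip : LipschitzOnWith (Real.toNNReal L) η (uIcc a b) := by
    refine LipschitzOnWith.of_dist_le' fun x hx y hy => ?_
    rw [uIcc_of_le hab] at hx hy
    have hx' : x ∈ Icc 0 T := ⟨ha.trans hx.1, hx.2.trans hb⟩
    have hy' : y ∈ Icc 0 T := ⟨ha.trans hy.1, hy.2.trans hb⟩
    rw [dist_eq_norm, Real.dist_eq]
    exact hL x hx' y hy'
  exact hlip.absolutelyContinuousOnInterval.integral_deriv_eq_sub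

/-- **Integration by parts against a primitive, Lipschitz test.** Let `F` be integrable on `(0,T)`,
`U = c + ∫_{(0,t]} F` for a.e. `t ∈ (0,T)`, and let `η` be Lipschitz on `[0,T]` with `η(t) = 0` for
`t ≥ T'`, where `T' < T`. Then `∫_{(0,T)} (U η' + F η) = −c η(0)` (`η' = deriv η`, defined a.e.):
Fubini on the triangle `{0 < r ≤ s < T}` and the fundamental theorem of calculus for the absolutely
continuous `η`. [cite: Brezis2011, Cor. 8.10 (W^{1,∞} = Lip)] -/
theorem setIntegral_mul_deriv_add_mul_eq_neg {U F η : ℝ → ℝ} {c T T' L : ℝ}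
    (hF : IntegrableOn F (Ioo 0 T)) (hU : ∀ᵐ t ∂(volume.restrict (Ioo 0 T)), U t = c + ∫ τ in Ioc 0 t, F τ)
    (hL0 : 0 ≤ L) (hL : ∀ t ∈ Icc 0 T, ∀ s ∈ Icc 0 T, ‖η t - η s‖ ≤ L * |t - s|)
    (hT' : T' < T) (hη0 : ∀ t, T' ≤ t → η t = 0) :
    ∫ t in Ioo 0 T, (U t * deriv η t + F t * η t) = -(c * η 0) := by
  rcases le_or_gt T 0 with hT0 | hT0
  · have hT'0 : T' ≤ 0 := by linarith
    rw [Ioo_eq_empty_of_le hT0, Measure.restrict_empty, integral_zero_measure, hη0 0 hT'0, mul_zero, neg_zero]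
  have hηT : η T = 0 := hη0 T hT'.le
  -- continuity and boundedness of `η` on `[0,T]`
  have hηc : ContinuousOn η (Icc 0 T) := by
    have hlip : LipschitzOnWith (Real.toNNReal L) η (Icc 0 T) :=
      LipschitzOnWith.of_dist_le' fun x hx y hy => by
        rw [dist_eq_norm, Real.dist_eq]; exact hL x hx y hy
    exact hlip.continuousOn
  obtain ⟨Cη, hCη⟩ := (isCompact_Icc (a := (0:ℝ)) (b := T)).exists_bound_of_continuousOn hηc
  -- integrability of the pieces on `(0,T]`
  have hF' : IntegrableOn F (Ioc 0 T) := hF.congr_set_ae Ioo_ae_eq_Ioc.symm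
  have hdm : AEStronglyMeasurable (deriv η) (volume.restrict (Ioc 0 T)) :=
    (measurable_deriv η).aestronglyMeasurable
  have hdb : ∀ᵐ t ∂(volume.restrict (Ioc 0 T)), ‖deriv η t‖ ≤ L := by
    rw [Measure.restrict_congr_set (Ioo_ae_eq_Ioc (μ := volume) (a := (0:ℝ)) (b := T)).symm]
    filter_upwards [ae_restrict_mem measurableSet_Ioo] with t ht
    exact norm_deriv_le_of_lipschitzOn hL0 hL ht
  have hd : IntegrableOn (deriv η) (Ioc 0 T) := IntegrableOn.of_bound measure_Ioc_lt_top hdm L hdb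
  have hηm : AEStronglyMeasurable η (volume.restrict (Ioc 0 T)) :=
    (hηc.mono Ioc_subset_Icc_self).aestronglyMeasurable measurableSet_Ioc
  have hηb : ∀ᵐ r ∂(volume.restrict (Ioc 0 T)), ‖η r‖ ≤ Cη := by
    filter_upwards [ae_restrict_mem measurableSet_Ioc] with r hr
    exact hCη r (Ioc_subset_Icc_self hr)
  have hηF : IntegrableOn (fun r => F r * η r) (Ioc 0 T) := hF'.mul_bdd hηm hηb
  -- the primitive `prim r = ∫_{(0,r]} F` is continuous on `[0,T]`, hence bounded
  have hFI : IntegrableOn F (Icc 0 T) := hF'.congr_set_ae Ioc_ae_eq_Icc.symm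
  have hprimc : ContinuousOn (fun r => ∫ s in Ioc 0 r, F s) (Icc 0 T) := intervalIntegral.continuousOn_primitive hFI
  obtain ⟨Cp, hCp⟩ := (isCompact_Icc (a := (0:ℝ)) (b := T)).exists_bound_of_continuousOn hprimc
  have hprimm : AEStronglyMeasurable (fun r => ∫ s in Ioc 0 r, F s) (volume.restrict (Ioc 0 T)) :=
    (hprimc.mono Ioc_subset_Icc_self).aestronglyMeasurable measurableSet_Ioc
  have hprimb : ∀ᵐ r ∂(volume.restrict (Ioc 0 T)), ‖∫ s in Ioc 0 r, F s‖ ≤ Cp := by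
    filter_upwards [ae_restrict_mem measurableSet_Ioc] with r hr
    exact hCp r (Ioc_subset_Icc_self hr)
  have hdprim : IntegrableOn (fun s => deriv η s * ∫ r in Ioc 0 s, F r) (Ioc 0 T) := hd.mul_bdd hprimm hprimb
  -- Fubini on the triangle and the fundamental theorem of calculus for `η`
  have key := FunctionSpaces.setIntegral_mul_setIntegral_add_symm hd hF'
  have h0 : ∫ s in Ioc 0 T, deriv η s = -η 0 := by
    rw [← intervalIntegral.integral_of_le hT0.le, intervalIntegral_deriv_eq_sub_of_lipschitzOn hL le_rfl hT0.le le_rfl,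
      hηT, zero_sub]
  have h1 : ∀ r ∈ Ioc 0 T, ∫ s in Ioc 0 r, deriv η s = η r - η 0 := fun r hr => by
    rw [← intervalIntegral.integral_of_le hr.1.le,
      intervalIntegral_deriv_eq_sub_of_lipschitzOn hL le_rfl hr.1.le hr.2]
  have h2 : ∫ r in Ioc 0 T, F r * ∫ s in Ioc 0 r, deriv η s =
      (∫ r in Ioc 0 T, F r * η r) - η 0 * ∫ r in Ioc 0 T, F r := by
    rw [← MeasureTheory.integral_const_mul, ← integral_sub hηF (hF'.const_mul _)]
    refine setIntegral_congr_fun measurableSet_Ioc fun r hr => ?_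
    rw [h1 r hr]
    ring
  rw [h2, h0] at key
  -- `∫_{(0,T]} η' · prim = -∫_{(0,T]} F η`
  have hprim : ∫ s in Ioc 0 T, deriv η s * ∫ r in Ioc 0 s, F r = -∫ r in Ioc 0 T, F r * η r := by linarith
  -- assemble on `(0,T)`: replace `U` by `c + prim`
  have hUae : ∀ᵐ t ∂(volume.restrict (Ioo 0 T)), U t * deriv η t + F t * η t =
      c * deriv η t + (deriv η t * ∫ r in Ioc 0 t, F r) + F t * η t := by
    filter_upwards [hU] with t ht
    rw [ht]
    ring
  have hA : IntegrableOn (fun t => c * deriv η t + deriv η t * ∫ r in Ioc 0 t, F r) (Ioc 0 T) :=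
    (hd.const_mul c).add hdprim
  rw [integral_congr_ae hUae, setIntegral_congr_set (Ioo_ae_eq_Ioc (μ := volume) (a := (0:ℝ)) (b := T)),
    integral_add hA hηF, integral_add (hd.const_mul c) hdprim,
    MeasureTheory.integral_const_mul, hprim, h0]
  ring

end OneDim

/-! ## §2 Uniform-in-time truncation errors of time-continuous space-smooth families -/

section Truncation

omit [DecidableEq d] in
/-- Smoothness of a pointwise finite sum of smooth fields. [folklore] -/
private theorem isSmooth_fun_sum₄ {ι : Type*} (s : Finset ι) {f : ι → UnitAddTorus d → EuclideanSpace ℝ d}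
    (hf : ∀ i ∈ s, FunctionSpaces.Torus.IsSmooth (f i)) :
    FunctionSpaces.Torus.IsSmooth (fun y => ∑ i ∈ s, f i y) := by
  have h : (fun y => ∑ i ∈ s, f i y) = ∑ i ∈ s, f i := by
    funext y; simp only [Finset.sum_apply]
  rw [h]
  exact Finset.sum_induction _ FunctionSpaces.Torus.IsSmooth (fun u v hu hv => hu.add hv)
    (FunctionSpaces.Torus.isSmooth_const 0) hf

/-- One elliptic step `b ↦ b − (4π²)⁻¹Δb` written with iterated partials: for smooth `g` and any word `l`,
`∂^l (g − (4π²)⁻¹Δg) = ∂^l g − (4π²)⁻¹ Σᵢ ∂^{l i i} g`. [folklore] -/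
private theorem iterPartialDeriv_step₄ {g : UnitAddTorus d → EuclideanSpace ℝ d}
    (hg : FunctionSpaces.Torus.IsSmooth g) (l : List d) :
    FunctionSpaces.Torus.iterPartialDeriv l
        (fun x => g x - (4 * Real.pi ^ 2)⁻¹ • FunctionSpaces.Torus.laplacian g x) =
      fun x => FunctionSpaces.Torus.iterPartialDeriv l g x +
        (-(4 * Real.pi ^ 2)⁻¹) • ∑ i, FunctionSpaces.Torus.iterPartialDeriv (l ++ [i, i]) g x := by
  set S : UnitAddTorus d → EuclideanSpace ℝ d := fun y => ∑ i, FunctionSpaces.Torus.partialDeriv i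
    (FunctionSpaces.Torus.partialDeriv i g) y with hS
  have hSs : FunctionSpaces.Torus.IsSmooth S :=
    isSmooth_fun_sum₄ _ fun i _ => (hg.partialDeriv i).partialDeriv i
  have hΔ : (fun x => g x - (4 * Real.pi ^ 2)⁻¹ • FunctionSpaces.Torus.laplacian g x) =
      fun x => g x + (-(4 * Real.pi ^ 2)⁻¹) • S x := by
    funext x
    rw [FunctionSpaces.Torus.laplacian_eq_sum_partialDeriv_partialDeriv hg, sub_eq_add_neg, neg_smul]
  have hcS : FunctionSpaces.Torus.IsSmooth (fun x => (-(4 * Real.pi ^ 2)⁻¹) • S x) := hSs.smul _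
  rw [hΔ, FunctionSpaces.Torus.iterPartialDeriv_add hg hcS l, FunctionSpaces.Torus.iterPartialDeriv_const_smul hSs _ l,
    hS, FunctionSpaces.Torus.iterPartialDeriv_finset_sum _ (fun i _ => (hg.partialDeriv i).partialDeriv i) l]
  have e : ∀ i : d, FunctionSpaces.Torus.iterPartialDeriv l
      (FunctionSpaces.Torus.partialDeriv i (FunctionSpaces.Torus.partialDeriv i g)) =
      FunctionSpaces.Torus.iterPartialDeriv (l ++ [i, i]) g := fun i => by
    rw [FunctionSpaces.Torus.iterPartialDeriv_append]
    rfl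
  funext x
  simp only [e]

/-- **Joint continuity survives the elliptic iterate.** For a family `g : ℝ → T^d → ℝ^d` with smooth
slices whose iterated partial derivatives of every order are jointly continuous, the same holds for
`t ↦ (1 − (4π²)⁻¹Δ)^m (g t)` (the Laplacian is `Σᵢ ∂ᵢ∂ᵢ` on smooth fields).
[cite: RobinsonRodrigoSadowski2016, Thm. 4.4 Step 4] -/
theorem continuous_uncurry_iterPartialDeriv_iterate {g : ℝ → UnitAddTorus d → EuclideanSpace ℝ d}
    (hs : ∀ t, FunctionSpaces.Torus.IsSmooth (g t))
    (hc : ∀ l : List d, Continuous (uncurry fun t x => FunctionSpaces.Torus.iterPartialDeriv l (g t) x))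
    (m : ℕ) (l : List d) :
    Continuous (uncurry fun t x => FunctionSpaces.Torus.iterPartialDeriv l
      ((fun b : UnitAddTorus d → EuclideanSpace ℝ d =>
        fun x => b x - (4 * Real.pi ^ 2)⁻¹ • FunctionSpaces.Torus.laplacian b x)^[m] (g t)) x) := by
  induction m generalizing g l with
  | zero => exact hc l
  | succ m ih =>
    have hs' : ∀ t, FunctionSpaces.Torus.IsSmooth
        (fun x => g t x - (4 * Real.pi ^ 2)⁻¹ • FunctionSpaces.Torus.laplacian (g t) x) :=
      fun t => (hs t).sub ((hs t).laplacian.smul _)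
    have hc' : ∀ l : List d, Continuous (uncurry fun t x => FunctionSpaces.Torus.iterPartialDeriv l
        (fun x => g t x - (4 * Real.pi ^ 2)⁻¹ • FunctionSpaces.Torus.laplacian (g t) x) x) := by
      intro l
      have e : (uncurry fun t x => FunctionSpaces.Torus.iterPartialDeriv l
          (fun x => g t x - (4 * Real.pi ^ 2)⁻¹ • FunctionSpaces.Torus.laplacian (g t) x) x) =
          fun p : ℝ × UnitAddTorus d => FunctionSpaces.Torus.iterPartialDeriv l (g p.1) p.2 +
            (-(4 * Real.pi ^ 2)⁻¹) • ∑ i, FunctionSpaces.Torus.iterPartialDeriv (l ++ [i, i]) (g p.1) p.2 := by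
        funext p
        simp only [uncurry, iterPartialDeriv_step₄ (hs p.1) l]
      rw [e]
      have hsum : Continuous fun p : ℝ × UnitAddTorus d =>
          ∑ i, FunctionSpaces.Torus.iterPartialDeriv (l ++ [i, i]) (g p.1) p.2 :=
        continuous_finsetSum _ fun i _ => hc (l ++ [i, i])
      have hsm : Continuous fun p : ℝ × UnitAddTorus d =>
          (-(4 * Real.pi ^ 2)⁻¹ : ℝ) • ∑ i, FunctionSpaces.Torus.iterPartialDeriv (l ++ [i, i]) (g p.1) p.2 :=
        hsum.const_smul (-(4 * Real.pi ^ 2)⁻¹ : ℝ)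
      exact (hc l).add hsm
    have h := ih hs' hc' l
    refine h.congr ?_
    rintro ⟨t, x⟩
    simp only [uncurry_apply_pair, Function.iterate_succ_apply]

/-- **Uniform-in-time truncation error** (Robinson–Rodrigo–Sadowski, Thm. 4.4 Step 4, "`P_Nψ → ψ`
uniformly", for time-continuous families): for `g : ℝ → T^d → ℝ^d` with smooth slices and jointly
continuous iterated partials of every order, and a compact time set `K`, there is a null sequence
`ε N ≥ 0` with `‖g t x − P_N (g t) x‖ ≤ ε N` for all `N`, `t ∈ K`, `x`.
[cite: RobinsonRodrigoSadowski2016, Thm. 4.4 Step 4] -/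
theorem exists_norm_sub_fourierTruncate_le_of_continuous {g : ℝ → UnitAddTorus d → EuclideanSpace ℝ d}
    (hs : ∀ t, FunctionSpaces.Torus.IsSmooth (g t))
    (hc : ∀ l : List d, Continuous (uncurry fun t x => FunctionSpaces.Torus.iterPartialDeriv l (g t) x))
    {K : Set ℝ} (hK : IsCompact K) :
    ∃ ε : ℕ → ℝ, Tendsto ε atTop (𝓝 0) ∧ (∀ N, 0 ≤ ε N) ∧ ∀ (N : ℕ), ∀ t ∈ K, ∀ x,
      ‖g t x - FunctionSpaces.Torus.fourierTruncate N (g t) x‖ ≤ ε N := by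
  -- the iterate `(1 − (4π²)⁻¹Δ)^{#d} (g t)` is jointly continuous, hence bounded on `K × T^d`
  set m := Fintype.card d with hm
  have hcont : Continuous (uncurry fun t x => ((fun b : UnitAddTorus d → EuclideanSpace ℝ d =>
      fun x => b x - (4 * Real.pi ^ 2)⁻¹ • FunctionSpaces.Torus.laplacian b x)^[m] (g t)) x) := by
    simpa using continuous_uncurry_iterPartialDeriv_iterate hs hc m []
  obtain ⟨C₀, hC₀⟩ := (hK.prod isCompact_univ).exists_bound_of_continuousOn
    (f := uncurry fun t x => ((fun b : UnitAddTorus d → EuclideanSpace ℝ d =>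
      fun x => b x - (4 * Real.pi ^ 2)⁻¹ • FunctionSpaces.Torus.laplacian b x)^[m] (g t)) x)
    hcont.continuousOn
  set C := max C₀ 0 with hCdef
  have hC0 : 0 ≤ C := le_max_right _ _
  have hC : ∀ p ∈ K ×ˢ (univ : Set (UnitAddTorus d)), ‖(uncurry fun t x => ((fun b : UnitAddTorus d → EuclideanSpace ℝ d =>
      fun x => b x - (4 * Real.pi ^ 2)⁻¹ • FunctionSpaces.Torus.laplacian b x)^[m] (g t)) x) p‖ ≤ C :=
    fun p hp => (hC₀ p hp).trans (le_max_left _ _)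
  refine ⟨fun N => C * ∑' k : {k // k ∉ FunctionSpaces.Torus.freqBall (d := d) N},
      ((1 + FunctionSpaces.Torus.freqNormSq (k : d → ℤ)) ^ Fintype.card d)⁻¹, ?_, ?_, ?_⟩
  · have h := FunctionSpaces.Torus.tendsto_tsum_compl_freqBall_inv_pow (d := d)
    simpa using h.const_mul C
  · intro N
    exact mul_nonneg hC0 (tsum_nonneg fun k => inv_nonneg.2 (pow_nonneg
      (add_nonneg zero_le_one (FunctionSpaces.Torus.freqNormSq_nonneg _)) _))
  · intro N t ht x
    have hK' : ∀ y, ‖((fun b : UnitAddTorus d → EuclideanSpace ℝ d =>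
        fun x => b x - (4 * Real.pi ^ 2)⁻¹ • FunctionSpaces.Torus.laplacian b x)^[Fintype.card d] (g t)) y‖ ≤ C :=
      fun y => hC (t, y) ⟨ht, mem_univ _⟩
    exact (FunctionSpaces.Torus.norm_sub_fourierTruncate_apply_le (hs t) N x).trans
      (FunctionSpaces.Torus.tsum_compl_norm_mFourierCoeff_le (hs t) hK' N)

end Truncation

/-! ## §3 The per-mode identity for a time-Lipschitz transversal coefficient -/

section PerMode

omit [Fintype d] [DecidableEq d] in
/-- Pulling a scalar out of a transport sum. [folklore] -/
private theorem modeRHS_sumpull₄ (k : d → ℤ) (μ : ℂ) (f : d → ℂ) [Fintype d] :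
    ∑ j, (2 * Real.pi * I * (k j)) * (μ * f j) = μ * ∑ j, (2 * Real.pi * I * (k j)) * f j := by
  rw [Finset.mul_sum]; exact Finset.sum_congr rfl fun j _ => by ring

omit [DecidableEq d] in
/-- The mode right-hand side `H(z) = −4π²⟪X, T_𝔸(k)z⟫ + B(z) + A B'(z)` is `ℂ`-linear in `z`:
`H(Σᵢ μᵢ eᵢ) = Σᵢ μᵢ H(eᵢ)`. [folklore] -/
private theorem modeRHS_sum_smul₄ {ι : Type*} (s : Finset ι) (𝔸 : Visc4 d) (k : d → ℤ) (A : ℝ)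
    (X : EuclideanSpace ℂ d) (F' G' : d → EuclideanSpace ℂ d) (μ : ι → ℂ) (e : ι → EuclideanSpace ℂ d) :
    (-(4 * Real.pi ^ 2 : ℝ) : ℂ) * ⟪X, symbT 𝔸 k (∑ i ∈ s, μ i • e i)⟫_ℂ +
        ((∑ j, (2 * Real.pi * I * (k j)) * ⟪F' j, ∑ i ∈ s, μ i • e i⟫_ℂ) +
          (A : ℂ) * ∑ j, (2 * Real.pi * I * (k j)) * ⟪G' j, ∑ i ∈ s, μ i • e i⟫_ℂ) =
      ∑ i ∈ s, μ i * ((-(4 * Real.pi ^ 2 : ℝ) : ℂ) * ⟪X, symbT 𝔸 k (e i)⟫_ℂ +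
        ((∑ j, (2 * Real.pi * I * (k j)) * ⟪F' j, e i⟫_ℂ) + (A : ℂ) * ∑ j, (2 * Real.pi * I * (k j)) * ⟪G' j, e i⟫_ℂ)) := by
  classical
  induction s using Finset.induction_on with
  | empty => simp
  | insert a s ha ih =>
    rw [Finset.sum_insert ha, Finset.sum_insert ha, ← ih]
    simp only [symbT_add, symbT_smul, inner_add_right, inner_smul_right, mul_add, Finset.sum_add_distrib,
      modeRHS_sumpull₄]
    ring

omit [DecidableEq d] in
/-- `⟪X, r • z⟫_ℂ = r ⟪X, z⟫_ℂ` for a real scalar. [folklore] -/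
private theorem inner_real_smul_right₄ (X z : EuclideanSpace ℂ d) (r : ℝ) : ⟪X, r • z⟫_ℂ = (r : ℂ) * ⟪X, z⟫_ℂ := by
  rw [RCLike.real_smul_eq_coe_smul (K := ℂ) r z, inner_smul_right]
  rfl

omit [DecidableEq d] in
/-- `‖𝓕(complexify ∘ f)(k)‖ ≤ ∫ ‖f‖` for integrable `f`. [folklore] -/
private theorem norm_mFourierCoeff_complexify_le₄ {f : UnitAddTorus d → EuclideanSpace ℝ d}
    (hf : Integrable f volume) (k : d → ℤ) :
    ‖mFourierCoeff (FunctionSpaces.EuclideanSpace.complexify ∘ f) k‖ ≤ ∫ x, ‖f x‖ := by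
  rw [FunctionSpaces.Torus.mFourierCoeff_eq_integral_volume]
  have hint : Integrable (fun x => mFourier (-k) x • (FunctionSpaces.EuclideanSpace.complexify ∘ f) x) volume :=
    FunctionSpaces.Torus.integrable_mFourier_smul' (FunctionSpaces.Torus.integrable_complexify_comp hf) k
  refine (norm_integral_le_integral_norm _).trans (integral_mono hint.norm hf.norm fun x => ?_)
  dsimp only
  rw [norm_smul, Function.comp_apply, FunctionSpaces.EuclideanSpace.norm_complexify]
  exact mul_le_of_le_one_left (norm_nonneg _) (((mFourier (-k)).norm_coe_le_norm x).trans_eq mFourier_norm)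

variable {T : ℝ} {Ψ : ℝ → UnitAddTorus d → EuclideanSpace ℝ d}

/-- **The Fourier modes of a time-Lipschitz test are time-Lipschitz**: on `[0,T]`,
`‖𝓕Ψ(t)(k) − 𝓕Ψ(s)(k)‖ ≤ L |t − s|` with the Lipschitz constant of `Ψ` (`‖𝓕f(k)‖ ≤ ∫‖f‖` on the
probability torus). [cite: RobinsonRodrigoSadowski2016, §4.1] -/
theorem IsLipschitzSpaceTimeTest.norm_mFourierCoeff_sub_le (hΨ : IsLipschitzSpaceTimeTest T Ψ) :
    ∃ L : ℝ, 0 ≤ L ∧ ∀ t ∈ Icc 0 T, ∀ s ∈ Icc 0 T, ∀ k : d → ℤ,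
      ‖mFourierCoeff (FunctionSpaces.EuclideanSpace.complexify ∘ Ψ t) k -
        mFourierCoeff (FunctionSpaces.EuclideanSpace.complexify ∘ Ψ s) k‖ ≤ L * |t - s| := by
  obtain ⟨L, hL0, hL⟩ := hΨ.lipschitz
  refine ⟨L, hL0, fun t ht s hs k => ?_⟩
  have hts : Integrable (fun x => Ψ t x - Ψ s x) volume :=
    ((hΨ.isSmooth_slice t).continuous.sub (hΨ.isSmooth_slice s).continuous).integrable_of_hasCompactSupport
      (HasCompactSupport.of_compactSpace _)
  have e : mFourierCoeff (FunctionSpaces.EuclideanSpace.complexify ∘ Ψ t) k -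
      mFourierCoeff (FunctionSpaces.EuclideanSpace.complexify ∘ Ψ s) k =
      mFourierCoeff (FunctionSpaces.EuclideanSpace.complexify ∘ fun x => Ψ t x - Ψ s x) k := by
    rw [FunctionSpaces.Torus.mFourierCoeff_eq_integral_volume, FunctionSpaces.Torus.mFourierCoeff_eq_integral_volume,
      FunctionSpaces.Torus.mFourierCoeff_eq_integral_volume, ← integral_sub]
    · refine integral_congr_ae (ae_of_all _ fun x => ?_)
      simp only [Function.comp_apply, map_sub, smul_sub]
    · exact FunctionSpaces.Torus.integrable_mFourier_smul'
        (FunctionSpaces.Torus.integrable_complexify_comp ((hΨ.isSmooth_slice t).continuous.integrable_of_hasCompactSupport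
          (HasCompactSupport.of_compactSpace _))) k
    · exact FunctionSpaces.Torus.integrable_mFourier_smul'
        (FunctionSpaces.Torus.integrable_complexify_comp ((hΨ.isSmooth_slice s).continuous.integrable_of_hasCompactSupport
          (HasCompactSupport.of_compactSpace _))) k
  rw [e]
  refine (norm_mFourierCoeff_complexify_le₄ hts k).trans ?_
  calc ∫ x, ‖Ψ t x - Ψ s x‖ ≤ ∫ _ : UnitAddTorus d, L * |t - s| :=
        integral_mono_of_nonneg (ae_of_all _ fun x => norm_nonneg _) (integrable_const _)
          (ae_of_all _ fun x => hL t ht s hs x)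
    _ = L * |t - s| := by simp

namespace IsWeakTensorPassiveVectorOn

variable {A : ℝ} {𝔸 : Visc4 d} {b w : ℝ → UnitAddTorus d → EuclideanSpace ℝ d}
  {w₀ : UnitAddTorus d → EuclideanSpace ℝ d}

/-- **The per-mode identity.** For a weak solution `w` (integrable datum), a time-Lipschitz space-smooth
divergence-free test `Ψ` and a frequency `k`, with `X(t) = ŵ(t)(k)`, `φ(t) = 𝓕Ψ(t)(k)` (transversal,
Lipschitz in `t`) and the mode right-hand side `H_t(z) = −4π²⟪X, T_𝔸(k)z⟫ + B_t(z) + A B'_t(z)`: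
`∫₀ᵀ (Re⟪X(t), φ'(t)⟫ + Re H_t(φ(t))) dt = −Re⟪ŵ₀(k), φ(0)⟫`. Proof: expand `φ(t)` in a real
orthonormal basis of the transversal subspace; each coordinate is Lipschitz and each tested mode
`Re⟪X, eₘ⟫` is `Re⟪X₀, eₘ⟫ + ∫ Re H(eₘ)` a.e. (`ae_re_inner_mFourierCoeff_eq`); integrate by parts
coordinate by coordinate (§1) and resum. [cite: DiPernaLions1989, §II.1 (13)–(14)] [cite: Brezis2011, Cor. 8.10 (W^{1,∞} = Lip)] -/
theorem integrableOn_and_setIntegral_re_inner_mode_deriv_add_eq (h : IsWeakTensorPassiveVectorOn A T 𝔸 b w₀ w)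
    (hw₀ : Integrable w₀ volume) (hΨ : IsLipschitzSpaceTimeTest T Ψ)
    (hΨdiv : ∀ t, FunctionSpaces.Torus.IsDivFree (Ψ t)) (k : d → ℤ) :
    IntegrableOn (fun t =>
      ((⟪mFourierCoeff (FunctionSpaces.EuclideanSpace.complexify ∘ w t) k,
          deriv (fun τ => mFourierCoeff (FunctionSpaces.EuclideanSpace.complexify ∘ Ψ τ) k) t⟫_ℂ).re +
        ((-(4 * Real.pi ^ 2 : ℝ) : ℂ) *
            ⟪mFourierCoeff (FunctionSpaces.EuclideanSpace.complexify ∘ w t) k,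
              symbT 𝔸 k (mFourierCoeff (FunctionSpaces.EuclideanSpace.complexify ∘ Ψ t) k)⟫_ℂ +
          ((∑ j, (2 * Real.pi * I * (k j)) *
              ⟪mFourierCoeff (FunctionSpaces.EuclideanSpace.complexify ∘ fun x => b t x j • w t x) k,
                mFourierCoeff (FunctionSpaces.EuclideanSpace.complexify ∘ Ψ t) k⟫_ℂ) +
            (A : ℂ) * ∑ j, (2 * Real.pi * I * (k j)) *
              ⟪mFourierCoeff (FunctionSpaces.EuclideanSpace.complexify ∘ fun x => w t x j • b t x) k,
                mFourierCoeff (FunctionSpaces.EuclideanSpace.complexify ∘ Ψ t) k⟫_ℂ)).re)) (Ioo 0 T) ∧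
    ∫ t in Ioo 0 T,
      ((⟪mFourierCoeff (FunctionSpaces.EuclideanSpace.complexify ∘ w t) k,
          deriv (fun τ => mFourierCoeff (FunctionSpaces.EuclideanSpace.complexify ∘ Ψ τ) k) t⟫_ℂ).re +
        ((-(4 * Real.pi ^ 2 : ℝ) : ℂ) *
            ⟪mFourierCoeff (FunctionSpaces.EuclideanSpace.complexify ∘ w t) k,
              symbT 𝔸 k (mFourierCoeff (FunctionSpaces.EuclideanSpace.complexify ∘ Ψ t) k)⟫_ℂ +
          ((∑ j, (2 * Real.pi * I * (k j)) *
              ⟪mFourierCoeff (FunctionSpaces.EuclideanSpace.complexify ∘ fun x => b t x j • w t x) k,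
                mFourierCoeff (FunctionSpaces.EuclideanSpace.complexify ∘ Ψ t) k⟫_ℂ) +
            (A : ℂ) * ∑ j, (2 * Real.pi * I * (k j)) *
              ⟪mFourierCoeff (FunctionSpaces.EuclideanSpace.complexify ∘ fun x => w t x j • b t x) k,
                mFourierCoeff (FunctionSpaces.EuclideanSpace.complexify ∘ Ψ t) k⟫_ℂ)).re) =
      -(⟪mFourierCoeff (FunctionSpaces.EuclideanSpace.complexify ∘ w₀) k,
          mFourierCoeff (FunctionSpaces.EuclideanSpace.complexify ∘ Ψ 0) k⟫_ℂ).re := by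
  classical
  obtain ⟨T', hT'T, hΨ0⟩ := hΨ.eventually_zero
  have hF0 : ∀ t, T' ≤ t → mFourierCoeff (FunctionSpaces.EuclideanSpace.complexify ∘ Ψ t) k = 0 := by
    intro t ht
    rw [hΨ0 t ht, FunctionSpaces.Torus.mFourierCoeff_eq_integral_volume]
    simp
  rcases le_or_gt T 0 with hT0 | hT0
  · rw [Ioo_eq_empty_of_le hT0, Measure.restrict_empty, integral_zero_measure, hF0 0 (by linarith),
      inner_zero_right, Complex.zero_re, neg_zero]
    exact ⟨integrableOn_empty, rfl⟩
  -- notation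
  set X : ℝ → EuclideanSpace ℂ d := fun t => mFourierCoeff (FunctionSpaces.EuclideanSpace.complexify ∘ w t) k with hX
  set φ : ℝ → EuclideanSpace ℂ d := fun t => mFourierCoeff (FunctionSpaces.EuclideanSpace.complexify ∘ Ψ t) k with hφ
  set X₀ : EuclideanSpace ℂ d := mFourierCoeff (FunctionSpaces.EuclideanSpace.complexify ∘ w₀) k with hX₀
  set Bf : ℝ → d → EuclideanSpace ℂ d := fun t j =>
    mFourierCoeff (FunctionSpaces.EuclideanSpace.complexify ∘ fun x => b t x j • w t x) k with hBf
  set Bf' : ℝ → d → EuclideanSpace ℂ d := fun t j =>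
    mFourierCoeff (FunctionSpaces.EuclideanSpace.complexify ∘ fun x => w t x j • b t x) k with hBf'
  set H : ℝ → EuclideanSpace ℂ d → ℂ := fun t z =>
    (-(4 * Real.pi ^ 2 : ℝ) : ℂ) * ⟪X t, symbT 𝔸 k z⟫_ℂ +
      ((∑ j, (2 * Real.pi * I * (k j)) * ⟪Bf t j, z⟫_ℂ) + (A : ℂ) * ∑ j, (2 * Real.pi * I * (k j)) * ⟪Bf' t j, z⟫_ℂ)
    with hH
  -- the real subspace of transversal vectors and a real orthonormal basis of it
  let Lk : EuclideanSpace ℂ d →ₗ[ℝ] ℂ :=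
    ((∑ j, (k j : ℂ) • (EuclideanSpace.proj j : EuclideanSpace ℂ d →L[ℂ] ℂ)).toLinearMap).restrictScalars ℝ
  have hLk : ∀ z : EuclideanSpace ℂ d, Lk z = ∑ j, (k j : ℂ) * z j := by
    intro z
    simp [Lk]
  let V : Submodule ℝ (EuclideanSpace ℂ d) := LinearMap.ker Lk
  have hφV : ∀ t, φ t ∈ V := fun t => by
    rw [LinearMap.mem_ker, hLk]
    exact FunctionSpaces.Torus.IsDivFree.sum_mul_mFourierCoeff_eq_zero (hΨ.isSmooth_slice t) (hΨdiv t) k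
  let bV := stdOrthonormalBasis ℝ V
  set e : Fin (Module.finrank ℝ V) → EuclideanSpace ℂ d := fun m => (bV m : EuclideanSpace ℂ d) with he
  have hz : ∀ m, ∑ j, (k j : ℂ) * e m j = 0 := fun m => by
    rw [← hLk]
    exact (bV m).2
  have he1 : ∀ m, ‖e m‖ = 1 := fun m => by
    rw [he]
    exact bV.orthonormal.1 m
  have hexp : ∀ v ∈ V, ∑ m, ⟪e m, v⟫_ℝ • e m = v := by
    intro v hv
    have h1 := bV.sum_repr' ⟨v, hv⟩
    have h2 := congrArg (fun z : V => (z : EuclideanSpace ℂ d)) h1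
    simpa [Submodule.coe_sum, Submodule.coe_smul, Submodule.coe_inner, he] using h2
  -- the real coordinates of `φ`
  set η : Fin (Module.finrank ℝ V) → ℝ → ℝ := fun m t => ⟪e m, φ t⟫_ℝ with hη
  have hφexp : ∀ t, φ t = ∑ m, η m t • e m := fun t => (hexp (φ t) (hφV t)).symm
  obtain ⟨L, hL0, hL⟩ := hΨ.norm_mFourierCoeff_sub_le
  have hηL : ∀ m, ∀ t ∈ Icc 0 T, ∀ s ∈ Icc 0 T, ‖η m t - η m s‖ ≤ L * |t - s| := by
    intro m t ht s hs
    rw [hη]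
    dsimp only
    rw [← inner_sub_right, Real.norm_eq_abs]
    refine (abs_real_inner_le_norm _ _).trans ?_
    rw [he1 m, one_mul]
    exact hL t ht s hs k
  have hη0 : ∀ m t, T' ≤ t → η m t = 0 := by
    intro m t ht
    rw [hη]
    dsimp only
    rw [hφ]
    dsimp only
    rw [hF0 t ht, inner_zero_right]
  -- the scalar data mode by mode
  set U : Fin (Module.finrank ℝ V) → ℝ → ℝ := fun m t => (⟪X t, e m⟫_ℂ).re with hU
  set F : Fin (Module.finrank ℝ V) → ℝ → ℝ := fun m t => (H t (e m)).re with hFdef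
  set c : Fin (Module.finrank ℝ V) → ℝ := fun m => (⟪X₀, e m⟫_ℂ).re with hc
  have hUae : ∀ m, ∀ᵐ t ∂(volume.restrict (Ioo 0 T)), U m t = c m + ∫ τ in Ioc 0 t, F m τ := fun m => by
    filter_upwards [h.ae_re_inner_mFourierCoeff_eq hw₀ k (c := fun _ => e m) (hz m)] with t ht
    exact ht
  have hFi : ∀ m, IntegrableOn (F m) (Ioo 0 T) := fun m =>
    (h.integrableOn_modeRHS k (e m)).re.congr (ae_of_all _ fun t => rfl)
  -- §1, coordinate by coordinate
  have hmode : ∀ m, ∫ t in Ioo 0 T, (U m t * deriv (η m) t + F m t * η m t) = -(c m * η m 0) := fun m =>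
    setIntegral_mul_deriv_add_mul_eq_neg (hFi m) (hUae m) hL0 (hηL m) hT'T (hη0 m)
  -- integrability of the coordinate summands on `(0,T)`
  have hηc : ∀ m, ContinuousOn (η m) (Icc 0 T) := fun m =>
    (LipschitzOnWith.of_dist_le' fun x hx y hy => by
      rw [dist_eq_norm, Real.dist_eq]; exact hηL m x hx y hy).continuousOn
  have hηb : ∀ m, ∃ C, ∀ t ∈ Icc 0 T, ‖η m t‖ ≤ C := fun m =>
    (isCompact_Icc (a := (0:ℝ)) (b := T)).exists_bound_of_continuousOn (hηc m)
  have hUi : ∀ m, IntegrableOn (U m) (Ioo 0 T) := fun m =>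
    ((h.integrableOn_mFourierCoeff k).inner_const (𝕜 := ℂ) (e m)).re.congr (ae_of_all _ fun t => rfl)
  have hsummand : ∀ m, IntegrableOn (fun t => U m t * deriv (η m) t + F m t * η m t) (Ioo 0 T) := by
    intro m
    obtain ⟨C, hC⟩ := hηb m
    refine ((hUi m).mul_bdd (c := L) (measurable_deriv (η m)).aestronglyMeasurable ?_).add
      ((hFi m).mul_bdd (c := C) ((hηc m).mono Ioo_subset_Icc_self |>.aestronglyMeasurable measurableSet_Ioo) ?_)
    · filter_upwards [ae_restrict_mem measurableSet_Ioo] with t ht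
      exact norm_deriv_le_of_lipschitzOn hL0 (hηL m) ht
    · filter_upwards [ae_restrict_mem measurableSet_Ioo] with t ht
      exact hC t (Ioo_subset_Icc_self ht)
  have hsum : ∫ t in Ioo 0 T, ∑ m, (U m t * deriv (η m) t + F m t * η m t) = -∑ m, c m * η m 0 := by
    rw [integral_finsetSum _ fun m _ => hsummand m, ← Finset.sum_neg_distrib]
    exact Finset.sum_congr rfl fun m _ => hmode m
  -- each coordinate is differentiable a.e. (Rademacher), hence `φ' = Σₘ ηₘ' eₘ` a.e.
  have hdiff : ∀ᵐ t ∂(volume.restrict (Ioo 0 T)), ∀ m, DifferentiableAt ℝ (η m) t := by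
    refine ae_all_iff.2 fun m => ?_
    have hlip : LipschitzOnWith (Real.toNNReal L) (η m) (Icc 0 T) :=
      LipschitzOnWith.of_dist_le' fun x hx y hy => by
        rw [dist_eq_norm, Real.dist_eq]; exact hηL m x hx y hy
    have h1 := hlip.ae_differentiableWithinAt_of_mem (μ := volume)
    filter_upwards [ae_restrict_mem measurableSet_Ioo, ae_restrict_of_ae (s := Ioo 0 T) h1] with t ht h1t
    exact (h1t (Ioo_subset_Icc_self ht)).differentiableAt (Icc_mem_nhds ht.1 ht.2)
  have hderiv : ∀ᵐ t ∂(volume.restrict (Ioo 0 T)), deriv φ t = ∑ m, deriv (η m) t • e m := by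
    filter_upwards [hdiff] with t ht
    have hφfun : φ = fun τ => ∑ m, η m τ • e m := funext hφexp
    have hd : HasDerivAt (fun τ => ∑ m, η m τ • e m) (∑ m, deriv (η m) t • e m) t :=
      HasDerivAt.fun_sum fun m _ => ((ht m).hasDerivAt).smul_const (e m)
    rw [hφfun]
    exact hd.deriv
  -- pointwise identification of the three sums
  have hI1 : ∀ᵐ t ∂(volume.restrict (Ioo 0 T)), (⟪X t, deriv φ t⟫_ℂ).re = ∑ m, U m t * deriv (η m) t := by
    filter_upwards [hderiv] with t ht
    rw [ht, inner_sum, Complex.re_sum]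
    refine Finset.sum_congr rfl fun m _ => ?_
    rw [inner_real_smul_right₄, Complex.re_ofReal_mul, hU]
    ring
  have hI2 : ∀ t, (H t (φ t)).re = ∑ m, F m t * η m t := by
    intro t
    have e1 : φ t = ∑ m ∈ Finset.univ, ((η m t : ℝ) : ℂ) • e m := by
      rw [hφexp t]
      exact Finset.sum_congr rfl fun m _ => RCLike.real_smul_eq_coe_smul (K := ℂ) (η m t) (e m)
    rw [hH]
    dsimp only
    rw [e1, modeRHS_sum_smul₄ Finset.univ 𝔸 k A (X t) (Bf t) (Bf' t) (fun m => ((η m t : ℝ) : ℂ)) e, Complex.re_sum]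
    refine Finset.sum_congr rfl fun m _ => ?_
    rw [Complex.re_ofReal_mul, hFdef, hH]
    dsimp only
    ring
  have hI3 : (⟪X₀, φ 0⟫_ℂ).re = ∑ m, c m * η m 0 := by
    rw [hφexp 0, inner_sum, Complex.re_sum]
    refine Finset.sum_congr rfl fun m _ => ?_
    rw [inner_real_smul_right₄, Complex.re_ofReal_mul, hc]
    ring
  -- assemble
  have hae : ∀ᵐ t ∂(volume.restrict (Ioo 0 T)), (⟪X t, deriv φ t⟫_ℂ).re + (H t (φ t)).re =
      ∑ m, (U m t * deriv (η m) t + F m t * η m t) := by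
    filter_upwards [hI1] with t ht
    rw [ht, hI2 t, ← Finset.sum_add_distrib]
  have hgoal : ∫ t in Ioo 0 T, ((⟪X t, deriv φ t⟫_ℂ).re + (H t (φ t)).re) = -(⟪X₀, φ 0⟫_ℂ).re := by
    rw [integral_congr_ae hae, hsum, hI3]
  have hint : IntegrableOn (fun t => (⟪X t, deriv φ t⟫_ℂ).re + (H t (φ t)).re) (Ioo 0 T) := by
    refine (integrable_finsetSum (Finset.univ : Finset (Fin (Module.finrank ℝ V))) fun m _ => hsummand m).congr ?_
    filter_upwards [hae] with t ht
    exact ht.symm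
  exact ⟨hint, hgoal⟩

end IsWeakTensorPassiveVectorOn

end PerMode

/-! ## §4 Summation over the Fourier ball -/

section Galerkin

/-- `viscAdj 𝔸` of a pointwise finite sum of smooth fields. [folklore] -/
private theorem viscAdj_fun_sum₄ (𝔸 : Visc4 d) {ι : Type*} (s : Finset ι)
    {G : ι → UnitAddTorus d → EuclideanSpace ℝ d} (hG : ∀ i, FunctionSpaces.Torus.IsSmooth (G i))
    (x : UnitAddTorus d) :
    viscAdj 𝔸 (fun y => ∑ i ∈ s, G i y) x = ∑ i ∈ s, viscAdj 𝔸 (G i) x := by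
  classical
  induction s using Finset.induction_on with
  | empty =>
    simp only [Finset.sum_empty]
    exact viscAdj_zero_field 𝔸 x
  | insert a s ha ih =>
    rw [Finset.sum_insert ha, ← ih]
    have e : (fun y => ∑ i ∈ insert a s, G i y) = G a + fun y => ∑ i ∈ s, G i y := by
      funext y
      rw [Finset.sum_insert ha]
      rfl
    rw [e, viscAdj_add_field 𝔸 (hG a) (isSmooth_fun_sum₄ s fun i _ => hG i)]

/-- **The tensor viscous pairing with a truncation as a spectral sum**: for an integrable `v` and any
field `ψ`, `∫ ⟪v, 𝓛_𝔸^*(P_N ψ)⟫ = Σ_{k ∈ ball N} Re(−4π² ⟪𝓕v(k), T_𝔸(k) 𝓕ψ(k)⟫)`.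
[cite: Frisch1995Turbulence, §9.6.3 eq. (9.57) p. 233] [cite: Grafakos2014, §3.1.1] -/
theorem integral_inner_viscAdj_fourierTruncate_eq_sum {v : UnitAddTorus d → EuclideanSpace ℝ d}
    (hv : Integrable v volume) (𝔸 : Visc4 d) (ψ : UnitAddTorus d → EuclideanSpace ℝ d) (N : ℕ) :
    ∫ x, ⟪v x, viscAdj 𝔸 (FunctionSpaces.Torus.fourierTruncate N ψ) x⟫_ℝ =
      ∑ k ∈ FunctionSpaces.Torus.freqBall N, ((-(4 * Real.pi ^ 2 : ℝ) : ℂ) *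
        ⟪mFourierCoeff (FunctionSpaces.EuclideanSpace.complexify ∘ v) k,
          symbT 𝔸 k (mFourierCoeff (FunctionSpaces.EuclideanSpace.complexify ∘ ψ) k)⟫_ℂ).re := by
  set cf : (d → ℤ) → EuclideanSpace ℂ d := fun k' => mFourierCoeff (FunctionSpaces.EuclideanSpace.complexify ∘ ψ) k'
    with hcf
  have hP : FunctionSpaces.Torus.fourierTruncate N ψ = fun y => ∑ k ∈ FunctionSpaces.Torus.freqBall N,
      FunctionSpaces.Torus.realTrigPoly {k} cf y := by
    funext y
    rw [FunctionSpaces.Torus.fourierTruncate_eq, FunctionSpaces.Torus.realTrigPoly_apply_eq_sum]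
    refine Finset.sum_congr rfl fun k _ => ?_
    rw [FunctionSpaces.Torus.realTrigPoly_apply_eq_sum, Finset.sum_singleton]
  have hsm : ∀ k : d → ℤ, FunctionSpaces.Torus.IsSmooth (FunctionSpaces.Torus.realTrigPoly {k} cf) := fun k =>
    FunctionSpaces.Torus.isSmooth_realTrigPoly {k} cf
  rw [hP]
  simp_rw [viscAdj_fun_sum₄ 𝔸 _ hsm, inner_sum]
  rw [integral_finsetSum _ fun k _ => FunctionSpaces.Torus.integrable_inner_of_continuous hv
    (isSmooth_viscAdj 𝔸 (hsm k)).continuous]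
  exact Finset.sum_congr rfl fun k _ => integral_inner_viscAdj_realTrigPoly_singleton hv 𝔸 k cf

variable {T : ℝ} {Ψ : ℝ → UnitAddTorus d → EuclideanSpace ℝ d}

/-- **The Fourier modes of a time-Lipschitz test are differentiable a.e. in time, with derivative the
mode of the time derivative**: for a.e. `t ∈ (0,T)`, `d/dt 𝓕Ψ(t)(k) = 𝓕(∂ₜΨ(t))(k)` (differentiation
under the integral sign for a Lipschitz integrand; `τ ↦ Ψ(τ,x)` is differentiable at a.e. `(t,x)` by
Rademacher and Fubini). [cite: Brezis2011, Cor. 8.10 (W^{1,∞} = Lip)] -/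
theorem IsLipschitzSpaceTimeTest.ae_hasDerivAt_mFourierCoeff (hΨ : IsLipschitzSpaceTimeTest T Ψ) (k : d → ℤ) :
    ∀ᵐ t ∂(volume.restrict (Ioo 0 T)),
      HasDerivAt (fun τ => mFourierCoeff (FunctionSpaces.EuclideanSpace.complexify ∘ Ψ τ) k)
        (mFourierCoeff (FunctionSpaces.EuclideanSpace.complexify ∘ FunctionSpaces.Torus.timeDeriv Ψ t) k) t := by
  obtain ⟨L, hL0, hL⟩ := hΨ.lipschitz
  have hcont : Continuous (uncurry fun (x : UnitAddTorus d) (τ : ℝ) => Ψ τ x) :=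
    hΨ.continuous_uncurry.comp continuous_swap
  -- `τ ↦ Ψ τ x` is differentiable at `t` for a.e. `x`, for a.e. `t`
  have hD : ∀ᵐ t ∂(volume.restrict (Ioo 0 T)), ∀ᵐ x ∂(volume : Measure (UnitAddTorus d)),
      DifferentiableAt ℝ (fun τ => Ψ τ x) t := by
    have hS : MeasurableSet {p : UnitAddTorus d × ℝ | DifferentiableAt ℝ (fun τ => Ψ τ p.1) p.2} :=
      measurableSet_of_differentiableAt_with_param (𝕜 := ℝ) (f := fun (x : UnitAddTorus d) (τ : ℝ) => Ψ τ x) hcont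
    have hx : ∀ x, ∀ᵐ t ∂(volume.restrict (Ioo 0 T)), DifferentiableAt ℝ (fun τ => Ψ τ x) t := by
      intro x
      have hlip : LipschitzOnWith (Real.toNNReal L) (fun τ => Ψ τ x) (Icc 0 T) :=
        LipschitzOnWith.of_dist_le' fun a ha b' hb => by
          rw [dist_eq_norm, Real.dist_eq]; exact hL a ha b' hb x
      have h1 := hlip.ae_differentiableWithinAt_of_mem (μ := volume)
      filter_upwards [ae_restrict_mem measurableSet_Ioo, ae_restrict_of_ae (s := Ioo 0 T) h1] with t ht h1t
      exact (h1t (Ioo_subset_Icc_self ht)).differentiableAt (Icc_mem_nhds ht.1 ht.2)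
    have hprod : ∀ᵐ z ∂((volume : Measure (UnitAddTorus d)).prod (volume.restrict (Ioo 0 T))),
        z ∈ {p : UnitAddTorus d × ℝ | DifferentiableAt ℝ (fun τ => Ψ τ p.1) p.2} :=
      (Measure.ae_prod_mem_iff_ae_ae_mem hS).2 (ae_of_all _ hx)
    have hswap := (Measure.measurePreserving_swap (μ := volume.restrict (Ioo 0 T))
      (ν := (volume : Measure (UnitAddTorus d)))).quasiMeasurePreserving.ae hprod
    exact Measure.ae_ae_of_ae_prod hswap
  filter_upwards [hD, ae_restrict_mem measurableSet_Ioo] with t hDt ht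
  -- differentiation under the integral sign
  set F : ℝ → UnitAddTorus d → EuclideanSpace ℂ d := fun τ x =>
    mFourier (-k) x • FunctionSpaces.EuclideanSpace.complexify (Ψ τ x) with hFdef
  set F' : UnitAddTorus d → EuclideanSpace ℂ d := fun x =>
    mFourier (-k) x • FunctionSpaces.EuclideanSpace.complexify (FunctionSpaces.Torus.timeDeriv Ψ t x) with hF'def
  have hF_meas : ∀ᶠ τ in 𝓝 t, AEStronglyMeasurable (F τ) volume :=
    Eventually.of_forall fun τ => ((mFourier (-k)).continuous.smul
      (FunctionSpaces.EuclideanSpace.complexify.continuous.comp (hΨ.isSmooth_slice τ).continuous)).aestronglyMeasurable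
  have hF_int : Integrable (F t) volume :=
    FunctionSpaces.Torus.integrable_mFourier_smul' (FunctionSpaces.Torus.integrable_complexify_comp
      ((hΨ.isSmooth_slice t).continuous.integrable_of_hasCompactSupport (HasCompactSupport.of_compactSpace _))) k
  have hmeas_td : Measurable fun x => FunctionSpaces.Torus.timeDeriv Ψ t x := by
    have hm := measurable_deriv_with_param (𝕜 := ℝ) (f := fun (x : UnitAddTorus d) (τ : ℝ) => Ψ τ x) hcont
    exact hm.comp (measurable_id.prodMk measurable_const)
  have hF'_meas : AEStronglyMeasurable F' volume :=
    (mFourier (-k)).continuous.aestronglyMeasurable.smul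
      (FunctionSpaces.EuclideanSpace.complexify.continuous.measurable.comp hmeas_td).aestronglyMeasurable
  have h_lipsch : ∀ᵐ x ∂(volume : Measure (UnitAddTorus d)), LipschitzOnWith (Real.nnabs L) (F · x) (Ioo 0 T) := by
    refine ae_of_all _ fun x => LipschitzOnWith.of_dist_le_mul fun a ha b' hb => ?_
    rw [hFdef]
    dsimp only
    rw [dist_eq_norm, ← smul_sub, norm_smul, ← map_sub, FunctionSpaces.EuclideanSpace.norm_complexify,
      Real.coe_nnabs, abs_of_nonneg hL0, Real.dist_eq]
    calc ‖mFourier (-k) x‖ * ‖Ψ a x - Ψ b' x‖ ≤ 1 * ‖Ψ a x - Ψ b' x‖ :=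
          mul_le_mul_of_nonneg_right (((mFourier (-k)).norm_coe_le_norm x).trans_eq mFourier_norm) (norm_nonneg _)
      _ ≤ L * |a - b'| := by rw [one_mul]; exact hL a (Ioo_subset_Icc_self ha) b' (Ioo_subset_Icc_self hb) x
  have h_diff : ∀ᵐ x ∂(volume : Measure (UnitAddTorus d)), HasDerivAt (F · x) (F' x) t := by
    filter_upwards [hDt] with x hx
    have h1 := (FunctionSpaces.EuclideanSpace.complexify (ι := d)).toContinuousLinearMap.hasFDerivAt.comp_hasDerivAt t
      hx.hasDerivAt
    exact h1.const_smul (mFourier (-k) x)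
  have key := hasDerivAt_integral_of_dominated_loc_of_lip (Ioo_mem_nhds ht.1 ht.2) hF_meas hF_int hF'_meas h_lipsch
    (integrable_const L) h_diff
  have e1 : (fun τ => mFourierCoeff (FunctionSpaces.EuclideanSpace.complexify ∘ Ψ τ) k) = fun τ => ∫ x, F τ x :=
    funext fun τ => by rw [FunctionSpaces.Torus.mFourierCoeff_eq_integral_volume]; rfl
  have e2 : mFourierCoeff (FunctionSpaces.EuclideanSpace.complexify ∘ FunctionSpaces.Torus.timeDeriv Ψ t) k =
      ∫ x, F' x := by
    rw [FunctionSpaces.Torus.mFourierCoeff_eq_integral_volume]; rfl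
  rw [e1, e2]
  exact key.2

namespace IsWeakTensorPassiveVectorOn

variable {A : ℝ} {𝔸 : Visc4 d} {b w : ℝ → UnitAddTorus d → EuclideanSpace ℝ d}
  {w₀ : UnitAddTorus d → EuclideanSpace ℝ d}

/-- **The Galerkin-level identity for a time-Lipschitz test.** Summing the per-mode identities over
the Fourier ball `‖k‖_∞ ≤ N` and reading the sums in `x`-space:
`∫₀ᵀ ( Σ_{ball} Re⟪𝓕(∂ₜΨ)(k), ŵ(k)⟫ + ∫⟪w, (b·∇)P_NΨ⟫ + ∫⟪w, 𝓛_𝔸^* P_NΨ⟫ + A∫⟪b, (w·∇)P_NΨ⟫ ) dt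
   = −Σ_{ball} Re⟪ŵ₀(k), 𝓕Ψ(0)(k)⟫`,
together with the integrability of the integrand on `(0,T)`.
[cite: DiPernaLions1989, §II.1 (13)–(14)] [cite: RobinsonRodrigoSadowski2016, Thm. 4.4 Step 4] -/
theorem integrableOn_and_setIntegral_galerkin_lipschitzTest (h : IsWeakTensorPassiveVectorOn A T 𝔸 b w₀ w)
    (hw₀ : Integrable w₀ volume) (hΨ : IsLipschitzSpaceTimeTest T Ψ)
    (hΨdiv : ∀ t, FunctionSpaces.Torus.IsDivFree (Ψ t)) (N : ℕ) :
    IntegrableOn (fun t =>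
      (∑ k ∈ FunctionSpaces.Torus.freqBall N,
          (⟪mFourierCoeff (FunctionSpaces.EuclideanSpace.complexify ∘ FunctionSpaces.Torus.timeDeriv Ψ t) k,
            mFourierCoeff (FunctionSpaces.EuclideanSpace.complexify ∘ w t) k⟫_ℂ).re) +
        ((∫ x, ⟪w t x, FunctionSpaces.Torus.convect (b t)
            (FunctionSpaces.Torus.fourierTruncate N (Ψ t)) x⟫_ℝ) +
          ((∫ x, ⟪w t x, viscAdj 𝔸 (FunctionSpaces.Torus.fourierTruncate N (Ψ t)) x⟫_ℝ) +
            A * ∫ x, ⟪b t x, FunctionSpaces.Torus.convect (w t)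
              (FunctionSpaces.Torus.fourierTruncate N (Ψ t)) x⟫_ℝ))) (Ioo 0 T) ∧
    ∫ t in Ioo 0 T,
      ((∑ k ∈ FunctionSpaces.Torus.freqBall N,
          (⟪mFourierCoeff (FunctionSpaces.EuclideanSpace.complexify ∘ FunctionSpaces.Torus.timeDeriv Ψ t) k,
            mFourierCoeff (FunctionSpaces.EuclideanSpace.complexify ∘ w t) k⟫_ℂ).re) +
        ((∫ x, ⟪w t x, FunctionSpaces.Torus.convect (b t)
            (FunctionSpaces.Torus.fourierTruncate N (Ψ t)) x⟫_ℝ) +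
          ((∫ x, ⟪w t x, viscAdj 𝔸 (FunctionSpaces.Torus.fourierTruncate N (Ψ t)) x⟫_ℝ) +
            A * ∫ x, ⟪b t x, FunctionSpaces.Torus.convect (w t)
              (FunctionSpaces.Torus.fourierTruncate N (Ψ t)) x⟫_ℝ))) =
      -∑ k ∈ FunctionSpaces.Torus.freqBall N,
        (⟪mFourierCoeff (FunctionSpaces.EuclideanSpace.complexify ∘ w₀) k,
          mFourierCoeff (FunctionSpaces.EuclideanSpace.complexify ∘ Ψ 0) k⟫_ℂ).re := by
  have hk := fun k => h.integrableOn_and_setIntegral_re_inner_mode_deriv_add_eq hw₀ hΨ hΨdiv k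
  -- a.e. in `t`: the modes of `Ψ` are differentiable with derivative the modes of `∂ₜΨ`, slices integrable
  have hD := ae_all_iff.2 fun k : d → ℤ => hΨ.ae_hasDerivAt_mFourierCoeff k
  have hae : ∀ᵐ t ∂(volume.restrict (Ioo 0 T)),
      (∑ k ∈ FunctionSpaces.Torus.freqBall N,
        ((⟪mFourierCoeff (FunctionSpaces.EuclideanSpace.complexify ∘ w t) k,
            deriv (fun τ => mFourierCoeff (FunctionSpaces.EuclideanSpace.complexify ∘ Ψ τ) k) t⟫_ℂ).re +
          ((-(4 * Real.pi ^ 2 : ℝ) : ℂ) *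
              ⟪mFourierCoeff (FunctionSpaces.EuclideanSpace.complexify ∘ w t) k,
                symbT 𝔸 k (mFourierCoeff (FunctionSpaces.EuclideanSpace.complexify ∘ Ψ t) k)⟫_ℂ +
            ((∑ j, (2 * Real.pi * I * (k j)) *
                ⟪mFourierCoeff (FunctionSpaces.EuclideanSpace.complexify ∘ fun x => b t x j • w t x) k,
                  mFourierCoeff (FunctionSpaces.EuclideanSpace.complexify ∘ Ψ t) k⟫_ℂ) +
              (A : ℂ) * ∑ j, (2 * Real.pi * I * (k j)) *
                ⟪mFourierCoeff (FunctionSpaces.EuclideanSpace.complexify ∘ fun x => w t x j • b t x) k,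
                  mFourierCoeff (FunctionSpaces.EuclideanSpace.complexify ∘ Ψ t) k⟫_ℂ)).re)) =
      (∑ k ∈ FunctionSpaces.Torus.freqBall N,
          (⟪mFourierCoeff (FunctionSpaces.EuclideanSpace.complexify ∘ FunctionSpaces.Torus.timeDeriv Ψ t) k,
            mFourierCoeff (FunctionSpaces.EuclideanSpace.complexify ∘ w t) k⟫_ℂ).re) +
        ((∫ x, ⟪w t x, FunctionSpaces.Torus.convect (b t)
            (FunctionSpaces.Torus.fourierTruncate N (Ψ t)) x⟫_ℝ) +
          ((∫ x, ⟪w t x, viscAdj 𝔸 (FunctionSpaces.Torus.fourierTruncate N (Ψ t)) x⟫_ℝ) +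
            A * ∫ x, ⟪b t x, FunctionSpaces.Torus.convect (w t)
              (FunctionSpaces.Torus.fourierTruncate N (Ψ t)) x⟫_ℝ)) := by
    filter_upwards [hD, h.ae_integrable_slice] with t hDt hτ
    have e : ∀ k ∈ FunctionSpaces.Torus.freqBall N,
        ((⟪mFourierCoeff (FunctionSpaces.EuclideanSpace.complexify ∘ w t) k,
            deriv (fun τ => mFourierCoeff (FunctionSpaces.EuclideanSpace.complexify ∘ Ψ τ) k) t⟫_ℂ).re +
          ((-(4 * Real.pi ^ 2 : ℝ) : ℂ) *
              ⟪mFourierCoeff (FunctionSpaces.EuclideanSpace.complexify ∘ w t) k,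
                symbT 𝔸 k (mFourierCoeff (FunctionSpaces.EuclideanSpace.complexify ∘ Ψ t) k)⟫_ℂ +
            ((∑ j, (2 * Real.pi * I * (k j)) *
                ⟪mFourierCoeff (FunctionSpaces.EuclideanSpace.complexify ∘ fun x => b t x j • w t x) k,
                  mFourierCoeff (FunctionSpaces.EuclideanSpace.complexify ∘ Ψ t) k⟫_ℂ) +
              (A : ℂ) * ∑ j, (2 * Real.pi * I * (k j)) *
                ⟪mFourierCoeff (FunctionSpaces.EuclideanSpace.complexify ∘ fun x => w t x j • b t x) k,
                  mFourierCoeff (FunctionSpaces.EuclideanSpace.complexify ∘ Ψ t) k⟫_ℂ)).re) =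
        (⟪mFourierCoeff (FunctionSpaces.EuclideanSpace.complexify ∘ FunctionSpaces.Torus.timeDeriv Ψ t) k,
            mFourierCoeff (FunctionSpaces.EuclideanSpace.complexify ∘ w t) k⟫_ℂ).re +
          (((∑ j, (2 * Real.pi * I * (k j)) *
                ⟪mFourierCoeff (FunctionSpaces.EuclideanSpace.complexify ∘ fun x => b t x j • w t x) k,
                  mFourierCoeff (FunctionSpaces.EuclideanSpace.complexify ∘ Ψ t) k⟫_ℂ).re) +
            ((((-(4 * Real.pi ^ 2 : ℝ) : ℂ) *
              ⟪mFourierCoeff (FunctionSpaces.EuclideanSpace.complexify ∘ w t) k,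
                symbT 𝔸 k (mFourierCoeff (FunctionSpaces.EuclideanSpace.complexify ∘ Ψ t) k)⟫_ℂ).re) +
              A * (∑ j, (2 * Real.pi * I * (k j)) *
                ⟪mFourierCoeff (FunctionSpaces.EuclideanSpace.complexify ∘ fun x => w t x j • b t x) k,
                  mFourierCoeff (FunctionSpaces.EuclideanSpace.complexify ∘ Ψ t) k⟫_ℂ).re)) := by
      intro k _
      rw [(hDt k).deriv, ← inner_conj_symm, Complex.conj_re, Complex.add_re, Complex.add_re, Complex.re_ofReal_mul]
      ring
    rw [Finset.sum_congr rfl e, Finset.sum_add_distrib, Finset.sum_add_distrib, Finset.sum_add_distrib,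
      ← Finset.mul_sum, ← integral_inner_convect_fourierTruncate_eq_sum hτ.2.1 (Ψ t) N,
      ← integral_inner_viscAdj_fourierTruncate_eq_sum hτ.1 𝔸 (Ψ t) N,
      ← integral_inner_convect_fourierTruncate_eq_sum hτ.2.2 (Ψ t) N]
  refine ⟨(integrable_finsetSum (FunctionSpaces.Torus.freqBall N) fun k _ => (hk k).1).congr hae, ?_⟩
  rw [← integral_congr_ae hae, integral_finsetSum _ fun k _ => (hk k).1, ← Finset.sum_neg_distrib]
  exact Finset.sum_congr rfl fun k _ => (hk k).2

end IsWeakTensorPassiveVectorOn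

end Galerkin

/-! ## §5 The limit `N → ∞` and the weak formulation for time-Lipschitz tests -/

section Limit

omit [DecidableEq d] in
/-- Cauchy–Schwarz for a finite sum of real parts of complex pairings. [folklore] -/
private theorem abs_sum_re_inner_le₄ (B : Finset (d → ℤ)) (a c : (d → ℤ) → EuclideanSpace ℂ d) :
    |∑ k ∈ B, (⟪a k, c k⟫_ℂ).re| ≤ Real.sqrt (∑ k ∈ B, ‖a k‖ ^ 2) * Real.sqrt (∑ k ∈ B, ‖c k‖ ^ 2) := by
  refine (Finset.abs_sum_le_sum_abs _ _).trans ?_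
  refine le_trans (Finset.sum_le_sum fun k _ => ?_) (Real.sum_mul_le_sqrt_mul_sqrt B (fun k => ‖a k‖) fun k => ‖c k‖)
  exact (Complex.abs_re_le_norm _).trans (norm_inner_le_norm _ _)

omit [DecidableEq d] in
/-- The Euclidean norm is bounded by the sum of the absolute values of the coordinates. [folklore] -/
private theorem norm_le_sum_abs₄ (z : EuclideanSpace ℝ d) : ‖z‖ ≤ ∑ l, |z l| := by
  have h0 : 0 ≤ ∑ l, |z l| := Finset.sum_nonneg fun l _ => abs_nonneg _
  rw [EuclideanSpace.norm_eq]
  calc Real.sqrt (∑ l, ‖z l‖ ^ 2) ≤ Real.sqrt ((∑ l, |z l|) ^ 2) := by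
        refine Real.sqrt_le_sqrt ?_
        rw [sq, Finset.sum_mul]
        refine Finset.sum_le_sum fun l _ => ?_
        rw [Real.norm_eq_abs, sq]
        exact mul_le_mul_of_nonneg_left (Finset.single_le_sum (fun i _ => abs_nonneg (z i)) (Finset.mem_univ l))
          (abs_nonneg _)
    _ = ∑ l, |z l| := Real.sqrt_sq h0

/-- **Transport pairing bound**: `|∫ ⟪v, (c·∇)G⟫| ≤ (#d · δ) ∫ ‖c‖ ‖v‖` when `‖∂ⱼG‖ ≤ δ` everywhere.
[cite: RobinsonRodrigoSadowski2016, Thm. 4.4 Step 4] -/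
theorem abs_integral_inner_convect_le_of_partialDeriv_le {v c G : UnitAddTorus d → EuclideanSpace ℝ d}
    (hG : FunctionSpaces.Torus.IsSmooth G) {δ : ℝ} (hδ : ∀ j x, ‖FunctionSpaces.Torus.partialDeriv j G x‖ ≤ δ)
    (hcv : Integrable (fun x => ‖c x‖ * ‖v x‖) volume) :
    |∫ x, ⟪v x, FunctionSpaces.Torus.convect c G x⟫_ℝ| ≤ (Fintype.card d * δ) * ∫ x, ‖c x‖ * ‖v x‖ := by
  rw [← Real.norm_eq_abs, ← MeasureTheory.integral_const_mul]
  refine norm_integral_le_of_norm_le (hcv.const_mul _) (ae_of_all _ fun x => ?_)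
  rw [Real.norm_eq_abs]
  have h1 := FunctionSpaces.Torus.norm_convect_le c (hG.isContDiff (n := 1) (by simp)) x
  have h2 : ∑ i, ‖FunctionSpaces.Torus.partialDeriv i G x‖ ≤ Fintype.card d * δ := by
    calc ∑ i, ‖FunctionSpaces.Torus.partialDeriv i G x‖ ≤ ∑ _i : d, δ := Finset.sum_le_sum fun i _ => hδ i x
      _ = Fintype.card d * δ := by rw [Finset.sum_const, Finset.card_univ, nsmul_eq_mul]
  calc |⟪v x, FunctionSpaces.Torus.convect c G x⟫_ℝ| ≤ ‖v x‖ * ‖FunctionSpaces.Torus.convect c G x‖ :=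
        abs_real_inner_le_norm _ _
    _ ≤ ‖v x‖ * (‖c x‖ * (Fintype.card d * δ)) :=
        mul_le_mul_of_nonneg_left (h1.trans (mul_le_mul_of_nonneg_left h2 (norm_nonneg _))) (norm_nonneg _)
    _ = Fintype.card d * δ * (‖c x‖ * ‖v x‖) := by ring

/-- **Viscous pairing bound**: `|∫ ⟪v, 𝓛_𝔸^*G⟫| ≤ (K_𝔸 · δ) ∫ ‖v‖` when `‖∂ₐ∂_bG‖ ≤ δ` everywhere,
`K_𝔸 = Σ |𝔸_{ialb}|`. [cite: RobinsonRodrigoSadowski2016, Thm. 4.4 Step 4] -/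
theorem abs_integral_inner_viscAdj_le_of_partialDeriv₂_le {v G : UnitAddTorus d → EuclideanSpace ℝ d}
    (𝔸 : Visc4 d) {δ : ℝ}
    (hδ : ∀ a b x, ‖FunctionSpaces.Torus.partialDeriv a (FunctionSpaces.Torus.partialDeriv b G) x‖ ≤ δ)
    (hv : Integrable v volume) :
    |∫ x, ⟪v x, viscAdj 𝔸 G x⟫_ℝ| ≤ ((∑ l, ∑ i, ∑ a, ∑ b, |𝔸 i a l b|) * δ) * ∫ x, ‖v x‖ := by
  rw [← Real.norm_eq_abs, ← MeasureTheory.integral_const_mul]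
  refine norm_integral_le_of_norm_le (hv.norm.const_mul _) (ae_of_all _ fun x => ?_)
  rw [Real.norm_eq_abs]
  have hz : ‖viscAdj 𝔸 G x‖ ≤ (∑ l, ∑ i, ∑ a, ∑ b, |𝔸 i a l b|) * δ := by
    refine (norm_le_sum_abs₄ _).trans ?_
    rw [Finset.sum_mul]
    refine Finset.sum_le_sum fun l _ => ?_
    rw [viscAdj_apply, Finset.sum_mul]
    refine (Finset.abs_sum_le_sum_abs _ _).trans (Finset.sum_le_sum fun i _ => ?_)
    rw [Finset.sum_mul]
    refine (Finset.abs_sum_le_sum_abs _ _).trans (Finset.sum_le_sum fun a _ => ?_)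
    rw [Finset.sum_mul]
    refine (Finset.abs_sum_le_sum_abs _ _).trans (Finset.sum_le_sum fun b' _ => ?_)
    rw [abs_mul]
    exact mul_le_mul_of_nonneg_left ((FunctionSpaces.Torus.abs_apply_le_norm _ i).trans (hδ a b' x)) (abs_nonneg _)
  calc |⟪v x, viscAdj 𝔸 G x⟫_ℝ| ≤ ‖v x‖ * ‖viscAdj 𝔸 G x‖ := abs_real_inner_le_norm _ _
    _ ≤ ‖v x‖ * ((∑ l, ∑ i, ∑ a, ∑ b, |𝔸 i a l b|) * δ) := mul_le_mul_of_nonneg_left hz (norm_nonneg _)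
    _ = (∑ l, ∑ i, ∑ a, ∑ b, |𝔸 i a l b|) * δ * ‖v x‖ := by ring

omit [DecidableEq d] in
/-- Integrability of `⟪v, g⟫` for integrable `v` and bounded measurable `g`. [folklore] -/
private theorem integrable_inner_of_bdd₄ {v g : UnitAddTorus d → EuclideanSpace ℝ d} (hv : Integrable v volume)
    (hg : AEStronglyMeasurable g volume) {C : ℝ} (hC : ∀ x, ‖g x‖ ≤ C) :
    Integrable (fun x => ⟪v x, g x⟫_ℝ) volume := by
  refine Integrable.mono' (hv.norm.mul_const C) (hv.1.inner hg) (ae_of_all _ fun x => ?_)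
  rw [Real.norm_eq_abs]
  exact (abs_real_inner_le_norm _ _).trans (mul_le_mul_of_nonneg_left (hC x) (norm_nonneg _))

/-- Integrability of the transport pairing `⟪v, (c·∇)G⟫` with a smooth `G`, given `cⱼ v ∈ L¹`. [folklore] -/
private theorem integrable_inner_convect₄ {v c G : UnitAddTorus d → EuclideanSpace ℝ d}
    (hcv : ∀ j, Integrable (fun x => c x j • v x) volume) (hG : FunctionSpaces.Torus.IsSmooth G) :
    Integrable (fun x => ⟪v x, FunctionSpaces.Torus.convect c G x⟫_ℝ) volume := by
  have e : (fun x => ⟪v x, FunctionSpaces.Torus.convect c G x⟫_ℝ) =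
      fun x => ∑ j, ⟪c x j • v x, FunctionSpaces.Torus.partialDeriv j G x⟫_ℝ := by
    funext x
    rw [FunctionSpaces.Torus.convect_eq_sum_smul_partialDeriv (hG.isContDiff (n := 1) (by simp)), inner_sum]
    refine Finset.sum_congr rfl fun j _ => ?_
    rw [real_inner_smul_right, real_inner_smul_left]
  rw [e]
  exact integrable_finsetSum _ fun j _ =>
    FunctionSpaces.Torus.integrable_inner_of_continuous (hcv j) (hG.partialDeriv j).continuous

/-- **Transport pairing bound, difference form**: `|∫⟪v,(c·∇)G₁⟫ − ∫⟪v,(c·∇)G₂⟫| ≤ (#d·δ) ∫‖c‖‖v‖` when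
`‖∂ⱼG₁ − ∂ⱼG₂‖ ≤ δ` everywhere. [cite: RobinsonRodrigoSadowski2016, Thm. 4.4 Step 4] -/
theorem abs_integral_inner_convect_sub_le_of_partialDeriv_le {v c G₁ G₂ : UnitAddTorus d → EuclideanSpace ℝ d}
    (hG₁ : FunctionSpaces.Torus.IsSmooth G₁) (hG₂ : FunctionSpaces.Torus.IsSmooth G₂) {δ : ℝ}
    (hδ : ∀ j x, ‖FunctionSpaces.Torus.partialDeriv j G₁ x - FunctionSpaces.Torus.partialDeriv j G₂ x‖ ≤ δ)
    (hcv : ∀ j, Integrable (fun x => c x j • v x) volume) (hcv' : Integrable (fun x => ‖c x‖ * ‖v x‖) volume) :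
    |(∫ x, ⟪v x, FunctionSpaces.Torus.convect c G₁ x⟫_ℝ) - ∫ x, ⟪v x, FunctionSpaces.Torus.convect c G₂ x⟫_ℝ| ≤
      (Fintype.card d * δ) * ∫ x, ‖c x‖ * ‖v x‖ := by
  rw [← integral_sub (integrable_inner_convect₄ hcv hG₁) (integrable_inner_convect₄ hcv hG₂), ← Real.norm_eq_abs,
    ← MeasureTheory.integral_const_mul]
  refine norm_integral_le_of_norm_le (hcv'.const_mul _) (ae_of_all _ fun x => ?_)
  rw [Real.norm_eq_abs, ← inner_sub_right]
  have hdiff : FunctionSpaces.Torus.convect c G₁ x - FunctionSpaces.Torus.convect c G₂ x =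
      ∑ i, c x i • (FunctionSpaces.Torus.partialDeriv i G₁ x - FunctionSpaces.Torus.partialDeriv i G₂ x) := by
    rw [FunctionSpaces.Torus.convect_eq_sum_smul_partialDeriv (hG₁.isContDiff (n := 1) (by simp)),
      FunctionSpaces.Torus.convect_eq_sum_smul_partialDeriv (hG₂.isContDiff (n := 1) (by simp)), ← Finset.sum_sub_distrib]
    exact Finset.sum_congr rfl fun i _ => (smul_sub _ _ _).symm
  have hn : ‖FunctionSpaces.Torus.convect c G₁ x - FunctionSpaces.Torus.convect c G₂ x‖ ≤ ‖c x‖ * (Fintype.card d * δ) := by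
    rw [hdiff]
    refine (norm_sum_le _ _).trans ?_
    calc ∑ i, ‖c x i • (FunctionSpaces.Torus.partialDeriv i G₁ x - FunctionSpaces.Torus.partialDeriv i G₂ x)‖
        ≤ ∑ _i : d, ‖c x‖ * δ := Finset.sum_le_sum fun i _ => by
          rw [norm_smul]
          exact mul_le_mul (by simpa [Real.norm_eq_abs] using FunctionSpaces.Torus.abs_apply_le_norm (c x) i)
            (hδ i x) (norm_nonneg _) (norm_nonneg _)
      _ = ‖c x‖ * (Fintype.card d * δ) := by rw [Finset.sum_const, Finset.card_univ, nsmul_eq_mul]; ring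
  calc |⟪v x, FunctionSpaces.Torus.convect c G₁ x - FunctionSpaces.Torus.convect c G₂ x⟫_ℝ|
      ≤ ‖v x‖ * ‖FunctionSpaces.Torus.convect c G₁ x - FunctionSpaces.Torus.convect c G₂ x‖ := abs_real_inner_le_norm _ _
    _ ≤ ‖v x‖ * (‖c x‖ * (Fintype.card d * δ)) := mul_le_mul_of_nonneg_left hn (norm_nonneg _)
    _ = Fintype.card d * δ * (‖c x‖ * ‖v x‖) := by ring

/-- **Viscous pairing bound, difference form**: `|∫⟪v,𝓛_𝔸^*G₁⟫ − ∫⟪v,𝓛_𝔸^*G₂⟫| ≤ (K_𝔸·δ) ∫‖v‖` when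
`‖∂ₐ∂_bG₁ − ∂ₐ∂_bG₂‖ ≤ δ` everywhere. [cite: RobinsonRodrigoSadowski2016, Thm. 4.4 Step 4] -/
theorem abs_integral_inner_viscAdj_sub_le_of_partialDeriv₂_le {v G₁ G₂ : UnitAddTorus d → EuclideanSpace ℝ d}
    (𝔸 : Visc4 d) (hG₁ : FunctionSpaces.Torus.IsSmooth G₁) (hG₂ : FunctionSpaces.Torus.IsSmooth G₂) {δ : ℝ}
    (hδ : ∀ a b x, ‖FunctionSpaces.Torus.partialDeriv a (FunctionSpaces.Torus.partialDeriv b G₁) x -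
      FunctionSpaces.Torus.partialDeriv a (FunctionSpaces.Torus.partialDeriv b G₂) x‖ ≤ δ)
    (hv : Integrable v volume) :
    |(∫ x, ⟪v x, viscAdj 𝔸 G₁ x⟫_ℝ) - ∫ x, ⟪v x, viscAdj 𝔸 G₂ x⟫_ℝ| ≤
      ((∑ l, ∑ i, ∑ a, ∑ b, |𝔸 i a l b|) * δ) * ∫ x, ‖v x‖ := by
  rw [← integral_sub (FunctionSpaces.Torus.integrable_inner_of_continuous hv (isSmooth_viscAdj 𝔸 hG₁).continuous)
    (FunctionSpaces.Torus.integrable_inner_of_continuous hv (isSmooth_viscAdj 𝔸 hG₂).continuous), ← Real.norm_eq_abs,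
    ← MeasureTheory.integral_const_mul]
  refine norm_integral_le_of_norm_le (hv.norm.const_mul _) (ae_of_all _ fun x => ?_)
  rw [Real.norm_eq_abs, ← inner_sub_right]
  have hz : ‖viscAdj 𝔸 G₁ x - viscAdj 𝔸 G₂ x‖ ≤ (∑ l, ∑ i, ∑ a, ∑ b, |𝔸 i a l b|) * δ := by
    refine (norm_le_sum_abs₄ _).trans ?_
    rw [Finset.sum_mul]
    refine Finset.sum_le_sum fun l _ => ?_
    rw [PiLp.sub_apply, viscAdj_apply, viscAdj_apply, ← Finset.sum_sub_distrib, Finset.sum_mul]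
    refine (Finset.abs_sum_le_sum_abs _ _).trans (Finset.sum_le_sum fun i _ => ?_)
    rw [← Finset.sum_sub_distrib, Finset.sum_mul]
    refine (Finset.abs_sum_le_sum_abs _ _).trans (Finset.sum_le_sum fun a _ => ?_)
    rw [← Finset.sum_sub_distrib, Finset.sum_mul]
    refine (Finset.abs_sum_le_sum_abs _ _).trans (Finset.sum_le_sum fun b' _ => ?_)
    rw [← mul_sub, abs_mul]
    refine mul_le_mul_of_nonneg_left ?_ (abs_nonneg _)
    have e : (FunctionSpaces.Torus.partialDeriv a (FunctionSpaces.Torus.partialDeriv b' G₁) x) i -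
        (FunctionSpaces.Torus.partialDeriv a (FunctionSpaces.Torus.partialDeriv b' G₂) x) i =
        (FunctionSpaces.Torus.partialDeriv a (FunctionSpaces.Torus.partialDeriv b' G₁) x -
          FunctionSpaces.Torus.partialDeriv a (FunctionSpaces.Torus.partialDeriv b' G₂) x) i := by
      rw [PiLp.sub_apply]
    rw [e]
    exact (FunctionSpaces.Torus.abs_apply_le_norm _ i).trans (hδ a b' x)
  calc |⟪v x, viscAdj 𝔸 G₁ x - viscAdj 𝔸 G₂ x⟫_ℝ| ≤ ‖v x‖ * ‖viscAdj 𝔸 G₁ x - viscAdj 𝔸 G₂ x‖ :=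
        abs_real_inner_le_norm _ _
    _ ≤ ‖v x‖ * ((∑ l, ∑ i, ∑ a, ∑ b, |𝔸 i a l b|) * δ) := mul_le_mul_of_nonneg_left hz (norm_nonneg _)
    _ = (∑ l, ∑ i, ∑ a, ∑ b, |𝔸 i a l b|) * δ * ‖v x‖ := by ring

omit [DecidableEq d] in
/-- **Cauchy–Schwarz–Bessel for a partial Parseval sum**: `|Σ_{k∈B} Re⟪û(k), v̂(k)⟫| ≤ ‖u‖₂ ‖v‖₂`.
[cite: Grafakos2014, Prop. 3.2.7 (3)] -/
theorem abs_sum_re_inner_mFourierCoeff_le {u v : UnitAddTorus d → EuclideanSpace ℝ d} (hu : MemLp u 2 volume)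
    (hv : MemLp v 2 volume) (B : Finset (d → ℤ)) :
    |∑ k ∈ B, (⟪mFourierCoeff (FunctionSpaces.EuclideanSpace.complexify ∘ u) k,
        mFourierCoeff (FunctionSpaces.EuclideanSpace.complexify ∘ v) k⟫_ℂ).re| ≤
      Real.sqrt (∫ x, ‖u x‖ ^ 2) * Real.sqrt (∫ x, ‖v x‖ ^ 2) := by
  refine (abs_sum_re_inner_le₄ B _ _).trans ?_
  have h1 := sum_le_hasSum B (fun k _ => sq_nonneg _) (FunctionSpaces.Torus.hasSum_sq_norm_mFourierCoeff_complexify hu)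
  have h2 := sum_le_hasSum B (fun k _ => sq_nonneg _) (FunctionSpaces.Torus.hasSum_sq_norm_mFourierCoeff_complexify hv)
  exact mul_le_mul (Real.sqrt_le_sqrt h1) (Real.sqrt_le_sqrt h2) (Real.sqrt_nonneg _) (Real.sqrt_nonneg _)

omit [DecidableEq d] in
/-- `∫ ‖f‖² ≤ C` from `∫⁻ ‖f‖ₑ² ≤ C`. [folklore] -/
private theorem integral_norm_sq_le_of_lintegral_le₄ {f : UnitAddTorus d → EuclideanSpace ℝ d}
    (hf : AEStronglyMeasurable f volume) {C : ℝ≥0} (h : ∫⁻ x, ‖f x‖ₑ ^ 2 ≤ C) : ∫ x, ‖f x‖ ^ 2 ≤ C := by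
  have e : ∫ x, ‖f x‖ ^ 2 = (∫⁻ x, ‖f x‖ₑ ^ 2).toReal := by
    rw [integral_eq_lintegral_of_nonneg_ae (ae_of_all _ fun x => sq_nonneg _) (hf.norm.pow 2)]
    congr 1
    refine lintegral_congr fun x => ?_
    rw [← ofReal_norm, ENNReal.ofReal_pow (norm_nonneg _)]
  rw [e]
  have hfin : (∫⁻ x, ‖f x‖ₑ ^ 2) ≠ ⊤ := (h.trans_lt ENNReal.coe_lt_top).ne
  have := (ENNReal.toReal_le_toReal hfin ENNReal.coe_ne_top).2 h
  simpa using this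

variable {T : ℝ} {Ψ : ℝ → UnitAddTorus d → EuclideanSpace ℝ d}

namespace IsLipschitzSpaceTimeTest

/-- The time derivative of a time-Lipschitz test is measurable in space at every time (the derivative of
a jointly continuous family is jointly measurable). [cite: Brezis2011, Cor. 8.10 (W^{1,∞} = Lip)] -/
theorem measurable_timeDeriv (hΨ : IsLipschitzSpaceTimeTest T Ψ) (t : ℝ) :
    Measurable fun x => FunctionSpaces.Torus.timeDeriv Ψ t x := by
  have hcont : Continuous (uncurry fun (x : UnitAddTorus d) (τ : ℝ) => Ψ τ x) :=
    hΨ.continuous_uncurry.comp continuous_swap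
  have hm := measurable_deriv_with_param (𝕜 := ℝ) (f := fun (x : UnitAddTorus d) (τ : ℝ) => Ψ τ x) hcont
  exact hm.comp (measurable_id.prodMk measurable_const)

/-- The time derivative of a time-Lipschitz test is square integrable in space, `t ∈ (0,T)` (it is bounded
by the Lipschitz constant). [cite: Brezis2011, Cor. 8.10 (W^{1,∞} = Lip)] -/
theorem memLp_two_timeDeriv (hΨ : IsLipschitzSpaceTimeTest T Ψ) {t : ℝ} (ht : t ∈ Ioo 0 T) :
    MemLp (FunctionSpaces.Torus.timeDeriv Ψ t) 2 volume := by
  obtain ⟨L, -, hL⟩ := hΨ.exists_bound_timeDeriv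
  exact MemLp.of_bound (hΨ.measurable_timeDeriv t).aestronglyMeasurable L (ae_of_all _ (hL t ht))

/-- Uniform bound of the first space derivatives on `[0,T] × T^d` (continuity on a compact set).
[cite: RobinsonRodrigoSadowski2016, Thm. 4.4 Step 4] -/
theorem exists_bound_partialDeriv (hΨ : IsLipschitzSpaceTimeTest T Ψ) :
    ∃ M : ℝ, ∀ t ∈ Icc 0 T, ∀ j x, ‖FunctionSpaces.Torus.partialDeriv j (Ψ t) x‖ ≤ M := by
  have hb : ∀ j : d, ∃ M : ℝ, ∀ t ∈ Icc 0 T, ∀ x, ‖FunctionSpaces.Torus.partialDeriv j (Ψ t) x‖ ≤ M := by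
    intro j
    obtain ⟨M, hM⟩ := (isCompact_Icc.prod isCompact_univ).exists_bound_of_continuousOn
      (f := uncurry fun t y => FunctionSpaces.Torus.partialDeriv j (Ψ t) y)
      (hΨ.continuous_uncurry_partialDeriv j).continuousOn
    exact ⟨M, fun t ht x => hM (t, x) ⟨ht, mem_univ _⟩⟩
  choose M hM using hb
  refine ⟨∑ j, |M j|, fun t ht j x => (hM j t ht x).trans ((le_abs_self _).trans ?_)⟩
  exact Finset.single_le_sum (fun i _ => abs_nonneg (M i)) (Finset.mem_univ j)

/-- Uniform bound of the second space derivatives on `[0,T] × T^d` (continuity on a compact set).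
[cite: RobinsonRodrigoSadowski2016, Thm. 4.4 Step 4] -/
theorem exists_bound_partialDeriv₂ (hΨ : IsLipschitzSpaceTimeTest T Ψ) :
    ∃ M : ℝ, ∀ t ∈ Icc 0 T, ∀ i j x,
      ‖FunctionSpaces.Torus.partialDeriv i (FunctionSpaces.Torus.partialDeriv j (Ψ t)) x‖ ≤ M := by
  have hb : ∀ p : d × d, ∃ M : ℝ, ∀ t ∈ Icc 0 T, ∀ x,
      ‖FunctionSpaces.Torus.partialDeriv p.1 (FunctionSpaces.Torus.partialDeriv p.2 (Ψ t)) x‖ ≤ M := by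
    intro p
    obtain ⟨M, hM⟩ := (isCompact_Icc.prod isCompact_univ).exists_bound_of_continuousOn
      (f := uncurry fun t y => FunctionSpaces.Torus.partialDeriv p.1 (FunctionSpaces.Torus.partialDeriv p.2 (Ψ t)) y)
      (hΨ.continuous_uncurry_partialDeriv₂ p.1 p.2).continuousOn
    exact ⟨M, fun t ht x => hM (t, x) ⟨ht, mem_univ _⟩⟩
  choose M hM using hb
  refine ⟨∑ p, |M p|, fun t ht i j x => (hM (i, j) t ht x).trans ((le_abs_self _).trans ?_)⟩
  exact Finset.single_le_sum (fun q _ => abs_nonneg (M q)) (Finset.mem_univ (i, j))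

/-- **Uniform convergence of the first derivatives of the truncations**:
`sup_{t ∈ [0,T], x, j} ‖∂ⱼΨ(t) − ∂ⱼP_NΨ(t)‖ → 0`. [cite: RobinsonRodrigoSadowski2016, Thm. 4.4 Step 4] -/
theorem exists_partialDeriv_sub_fourierTruncate_le (hΨ : IsLipschitzSpaceTimeTest T Ψ) :
    ∃ ε : ℕ → ℝ, Tendsto ε atTop (𝓝 0) ∧ (∀ N, 0 ≤ ε N) ∧ ∀ (N : ℕ), ∀ t ∈ Icc 0 T, ∀ j x,
      ‖FunctionSpaces.Torus.partialDeriv j (Ψ t) x -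
        FunctionSpaces.Torus.partialDeriv j (FunctionSpaces.Torus.fourierTruncate N (Ψ t)) x‖ ≤ ε N := by
  have hj : ∀ j : d, ∃ ε : ℕ → ℝ, Tendsto ε atTop (𝓝 0) ∧ (∀ N, 0 ≤ ε N) ∧ ∀ (N : ℕ), ∀ t ∈ Icc 0 T, ∀ x,
      ‖FunctionSpaces.Torus.partialDeriv j (Ψ t) x -
        FunctionSpaces.Torus.fourierTruncate N (FunctionSpaces.Torus.partialDeriv j (Ψ t)) x‖ ≤ ε N := by
    intro j
    refine exists_norm_sub_fourierTruncate_le_of_continuous (g := fun t => FunctionSpaces.Torus.partialDeriv j (Ψ t))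
      (fun t => (hΨ.isSmooth_slice t).partialDeriv j) (fun l => ?_) isCompact_Icc
    have e : (uncurry fun t x => FunctionSpaces.Torus.iterPartialDeriv l (FunctionSpaces.Torus.partialDeriv j (Ψ t)) x) =
        uncurry fun t x => FunctionSpaces.Torus.iterPartialDeriv (l ++ [j]) (Ψ t) x := by
      funext p
      simp only [uncurry, FunctionSpaces.Torus.iterPartialDeriv_append, FunctionSpaces.Torus.iterPartialDeriv_cons,
        FunctionSpaces.Torus.iterPartialDeriv_nil]
    rw [e]
    exact hΨ.continuous_uncurry_iterPartialDeriv (l ++ [j])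
  choose ε hε0 hεnn hε using hj
  refine ⟨fun N => ∑ j, ε j N, ?_, fun N => Finset.sum_nonneg fun j _ => hεnn j N, fun N t ht j x => ?_⟩
  · have h := tendsto_finsetSum (Finset.univ : Finset d) fun j _ => hε0 j
    simpa using h
  · rw [FunctionSpaces.Torus.partialDeriv_fourierTruncate (hΨ.isSmooth_slice t) N j x]
    exact (hε j N t ht x).trans (Finset.single_le_sum (fun i _ => hεnn i N) (Finset.mem_univ j))

/-- **Uniform convergence of the second derivatives of the truncations**:
`sup_{t ∈ [0,T], x, a, b} ‖∂ₐ∂_bΨ(t) − ∂ₐ∂_bP_NΨ(t)‖ → 0`. [cite: RobinsonRodrigoSadowski2016, Thm. 4.4 Step 4] -/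
theorem exists_partialDeriv₂_sub_fourierTruncate_le (hΨ : IsLipschitzSpaceTimeTest T Ψ) :
    ∃ ε : ℕ → ℝ, Tendsto ε atTop (𝓝 0) ∧ (∀ N, 0 ≤ ε N) ∧ ∀ (N : ℕ), ∀ t ∈ Icc 0 T, ∀ a b x,
      ‖FunctionSpaces.Torus.partialDeriv a (FunctionSpaces.Torus.partialDeriv b (Ψ t)) x -
        FunctionSpaces.Torus.partialDeriv a (FunctionSpaces.Torus.partialDeriv b
          (FunctionSpaces.Torus.fourierTruncate N (Ψ t))) x‖ ≤ ε N := by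
  have hp : ∀ p : d × d, ∃ ε : ℕ → ℝ, Tendsto ε atTop (𝓝 0) ∧ (∀ N, 0 ≤ ε N) ∧ ∀ (N : ℕ), ∀ t ∈ Icc 0 T, ∀ x,
      ‖FunctionSpaces.Torus.partialDeriv p.1 (FunctionSpaces.Torus.partialDeriv p.2 (Ψ t)) x -
        FunctionSpaces.Torus.fourierTruncate N
          (FunctionSpaces.Torus.partialDeriv p.1 (FunctionSpaces.Torus.partialDeriv p.2 (Ψ t))) x‖ ≤ ε N := by
    intro p
    refine exists_norm_sub_fourierTruncate_le_of_continuous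
      (g := fun t => FunctionSpaces.Torus.partialDeriv p.1 (FunctionSpaces.Torus.partialDeriv p.2 (Ψ t)))
      (fun t => ((hΨ.isSmooth_slice t).partialDeriv p.2).partialDeriv p.1) (fun l => ?_) isCompact_Icc
    have e : (uncurry fun t x => FunctionSpaces.Torus.iterPartialDeriv l
        (FunctionSpaces.Torus.partialDeriv p.1 (FunctionSpaces.Torus.partialDeriv p.2 (Ψ t))) x) =
        uncurry fun t x => FunctionSpaces.Torus.iterPartialDeriv (l ++ [p.1, p.2]) (Ψ t) x := by
      funext q
      simp only [uncurry, FunctionSpaces.Torus.iterPartialDeriv_append, FunctionSpaces.Torus.iterPartialDeriv_cons,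
        FunctionSpaces.Torus.iterPartialDeriv_nil]
    rw [e]
    exact hΨ.continuous_uncurry_iterPartialDeriv (l ++ [p.1, p.2])
  choose ε hε0 hεnn hε using hp
  refine ⟨fun N => ∑ p, ε p N, ?_, fun N => Finset.sum_nonneg fun p _ => hεnn p N, fun N t ht a b' x => ?_⟩
  · have h := tendsto_finsetSum (Finset.univ : Finset (d × d)) fun p _ => hε0 p
    simpa using h
  · have e2 : FunctionSpaces.Torus.partialDeriv a (FunctionSpaces.Torus.partialDeriv b'
        (FunctionSpaces.Torus.fourierTruncate N (Ψ t))) x =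
        FunctionSpaces.Torus.fourierTruncate N
          (FunctionSpaces.Torus.partialDeriv a (FunctionSpaces.Torus.partialDeriv b' (Ψ t))) x := by
      have e1 : FunctionSpaces.Torus.partialDeriv b' (FunctionSpaces.Torus.fourierTruncate N (Ψ t)) =
          FunctionSpaces.Torus.fourierTruncate N (FunctionSpaces.Torus.partialDeriv b' (Ψ t)) :=
        funext fun y => FunctionSpaces.Torus.partialDeriv_fourierTruncate (hΨ.isSmooth_slice t) N b' y
      rw [e1, FunctionSpaces.Torus.partialDeriv_fourierTruncate ((hΨ.isSmooth_slice t).partialDeriv b') N a x]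
    rw [e2]
    exact (hε (a, b') N t ht x).trans (Finset.single_le_sum (fun q _ => hεnn q N) (Finset.mem_univ (a, b')))

end IsLipschitzSpaceTimeTest

namespace IsWeakTensorPassiveVectorOn

variable {A : ℝ} {𝔸 : Visc4 d} {b w : ℝ → UnitAddTorus d → EuclideanSpace ℝ d}
  {w₀ : UnitAddTorus d → EuclideanSpace ℝ d}

/-- **The weak formulation holds for time-Lipschitz, space-smooth tests.** For a weak solution `w` of
`∂ₜw + (b·∇)w + A (w·∇)b + ∇π = 𝓛_𝔸 w`, `∇·w = 0` (class `IsWeakTensorPassiveVectorOn`, jointly smooth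
tests) with datum `w₀ ∈ L²`, and every `Ψ` smooth in space, Lipschitz in time on `[0,T]`, vanishing
near `T`, divergence-free at each time (`IsLipschitzSpaceTimeTest`):
`∫₀ᵀ∫ (⟪w, ∂ₜΨ + (b·∇)Ψ + 𝓛_𝔸^*Ψ⟫ + A⟪b, (w·∇)Ψ⟫) dx dt + ∫⟪w₀, Ψ(0)⟫ = 0`.
Proof: the Galerkin-level identities (§4) and `N → ∞` by dominated convergence in `t`, using Parseval
for the `∂ₜΨ` and datum pairings and the uniform convergence of `∇P_NΨ`, `∇²P_NΨ` (§2) for the transport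
and viscous pairings. [cite: DiPernaLions1989, §II.1 (13)–(14)] [cite: RobinsonRodrigoSadowski2016, Thm. 4.4 Step 4] -/
theorem weak_eq_of_isLipschitzSpaceTimeTest (h : IsWeakTensorPassiveVectorOn A T 𝔸 b w₀ w)
    (hw₀ : MemLp w₀ 2 volume) (hΨ : IsLipschitzSpaceTimeTest T Ψ)
    (hΨdiv : ∀ t, FunctionSpaces.Torus.IsDivFree (Ψ t)) :
    (∫ t in Ioo 0 T, ∫ x, (⟪w t x, FunctionSpaces.Torus.timeDeriv Ψ t x +
          FunctionSpaces.Torus.convect (b t) (Ψ t) x + viscAdj 𝔸 (Ψ t) x⟫_ℝ +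
        A * ⟪b t x, FunctionSpaces.Torus.convect (w t) (Ψ t) x⟫_ℝ)) +
      ∫ x, ⟪w₀ x, Ψ 0 x⟫_ℝ = 0 := by
  have hw₀i : Integrable w₀ volume := hw₀.integrable one_le_two
  have hG := fun N => h.integrableOn_and_setIntegral_galerkin_lipschitzTest hw₀i hΨ hΨdiv N
  -- constants
  obtain ⟨L, hL0, hL⟩ := hΨ.exists_bound_timeDeriv
  obtain ⟨M₁, hM₁⟩ := hΨ.exists_bound_partialDeriv
  obtain ⟨M₂, hM₂⟩ := hΨ.exists_bound_partialDeriv₂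
  obtain ⟨ε₁, hε₁0, hε₁nn, hε₁⟩ := hΨ.exists_partialDeriv_sub_fourierTruncate_le
  obtain ⟨ε₂, hε₂0, hε₂nn, hε₂⟩ := hΨ.exists_partialDeriv₂_sub_fourierTruncate_le
  obtain ⟨E₁, hE₁⟩ := hε₁0.bddAbove_range
  obtain ⟨E₂, hE₂⟩ := hε₂0.bddAbove_range
  have hE₁' : ∀ N, ε₁ N ≤ E₁ := fun N => hE₁ ⟨N, rfl⟩
  have hE₂' : ∀ N, ε₂ N ≤ E₂ := fun N => hE₂ ⟨N, rfl⟩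
  obtain ⟨C, hC⟩ := h.ae_lintegral_sq_le
  set K𝔸 : ℝ := ∑ l, ∑ i, ∑ a, ∑ b, |𝔸 i a l b| with hK𝔸
  have hsmP : ∀ N t, FunctionSpaces.Torus.IsSmooth (FunctionSpaces.Torus.fourierTruncate N (Ψ t)) := fun N t =>
    FunctionSpaces.Torus.isSmooth_fourierTruncate N (Ψ t)
  -- derivative bounds of the truncations, `t ∈ [0,T]`
  have hdP : ∀ N, ∀ t ∈ Icc 0 T, ∀ j x,
      ‖FunctionSpaces.Torus.partialDeriv j (FunctionSpaces.Torus.fourierTruncate N (Ψ t)) x‖ ≤ M₁ + E₁ := by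
    intro N t ht j x
    have h1 := hε₁ N t ht j x
    have h2 := hM₁ t ht j x
    calc ‖FunctionSpaces.Torus.partialDeriv j (FunctionSpaces.Torus.fourierTruncate N (Ψ t)) x‖
        ≤ ‖FunctionSpaces.Torus.partialDeriv j (Ψ t) x‖ + ‖FunctionSpaces.Torus.partialDeriv j (Ψ t) x -
            FunctionSpaces.Torus.partialDeriv j (FunctionSpaces.Torus.fourierTruncate N (Ψ t)) x‖ :=
          norm_le_insert _ _
      _ ≤ M₁ + E₁ := add_le_add h2 (h1.trans (hE₁' N))
  have hdP₂ : ∀ N, ∀ t ∈ Icc 0 T, ∀ i j x,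
      ‖FunctionSpaces.Torus.partialDeriv i (FunctionSpaces.Torus.partialDeriv j
        (FunctionSpaces.Torus.fourierTruncate N (Ψ t))) x‖ ≤ M₂ + E₂ := by
    intro N t ht i j x
    have h1 := hε₂ N t ht i j x
    have h2 := hM₂ t ht i j x
    calc ‖FunctionSpaces.Torus.partialDeriv i (FunctionSpaces.Torus.partialDeriv j
          (FunctionSpaces.Torus.fourierTruncate N (Ψ t))) x‖
        ≤ ‖FunctionSpaces.Torus.partialDeriv i (FunctionSpaces.Torus.partialDeriv j (Ψ t)) x‖ +
            ‖FunctionSpaces.Torus.partialDeriv i (FunctionSpaces.Torus.partialDeriv j (Ψ t)) x -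
              FunctionSpaces.Torus.partialDeriv i (FunctionSpaces.Torus.partialDeriv j
                (FunctionSpaces.Torus.fourierTruncate N (Ψ t))) x‖ :=
          norm_le_insert _ _
      _ ≤ M₂ + E₂ := add_le_add h2 (h1.trans (hE₂' N))
  -- integrable functions of `t`
  have hIbw : Integrable (fun t => ∫ x, ‖b t x‖ * ‖w t x‖) (volume.restrict (Ioo 0 T)) :=
    h.integrable_norm_carrier_mul_norm.integral_prod_left
  have hIw : Integrable (fun t => ∫ x, ‖w t x‖) (volume.restrict (Ioo 0 T)) :=
    h.integrable_uncurry.norm.integral_prod_left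
  have hbw_slice : ∀ᵐ t ∂(volume.restrict (Ioo 0 T)), Integrable (fun x => ‖b t x‖ * ‖w t x‖) volume :=
    h.integrable_norm_carrier_mul_norm.prod_right_ae
  -- the dominating function
  set bound : ℝ → ℝ := fun t => L * Real.sqrt C +
    ((Fintype.card d * (M₁ + E₁)) * (∫ x, ‖b t x‖ * ‖w t x‖) +
      ((K𝔸 * (M₂ + E₂)) * (∫ x, ‖w t x‖) +
        |A| * ((Fintype.card d * (M₁ + E₁)) * (∫ x, ‖b t x‖ * ‖w t x‖)))) with hbound
  have hb1 : Integrable (fun t => (Fintype.card d * (M₁ + E₁)) * (∫ x, ‖b t x‖ * ‖w t x‖)) (volume.restrict (Ioo 0 T)) :=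
    hIbw.const_mul _
  have hb2 : Integrable (fun t => (K𝔸 * (M₂ + E₂)) * (∫ x, ‖w t x‖)) (volume.restrict (Ioo 0 T)) := hIw.const_mul _
  have hb3 : Integrable (fun t => |A| * ((Fintype.card d * (M₁ + E₁)) * (∫ x, ‖b t x‖ * ‖w t x‖)))
      (volume.restrict (Ioo 0 T)) := hb1.const_mul _
  have hb23 : Integrable (fun t => (K𝔸 * (M₂ + E₂)) * (∫ x, ‖w t x‖) +
      |A| * ((Fintype.card d * (M₁ + E₁)) * (∫ x, ‖b t x‖ * ‖w t x‖))) (volume.restrict (Ioo 0 T)) := hb2.add hb3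
  have hb123 : Integrable (fun t => (Fintype.card d * (M₁ + E₁)) * (∫ x, ‖b t x‖ * ‖w t x‖) +
      ((K𝔸 * (M₂ + E₂)) * (∫ x, ‖w t x‖) +
        |A| * ((Fintype.card d * (M₁ + E₁)) * (∫ x, ‖b t x‖ * ‖w t x‖)))) (volume.restrict (Ioo 0 T)) := hb1.add hb23
  have hbound_int : Integrable bound (volume.restrict (Ioo 0 T)) := (integrable_const _).add hb123
  -- the Galerkin integrands and their limit
  set GN : ℕ → ℝ → ℝ := fun N t =>
    (∑ k ∈ FunctionSpaces.Torus.freqBall N,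
        (⟪mFourierCoeff (FunctionSpaces.EuclideanSpace.complexify ∘ FunctionSpaces.Torus.timeDeriv Ψ t) k,
          mFourierCoeff (FunctionSpaces.EuclideanSpace.complexify ∘ w t) k⟫_ℂ).re) +
      ((∫ x, ⟪w t x, FunctionSpaces.Torus.convect (b t) (FunctionSpaces.Torus.fourierTruncate N (Ψ t)) x⟫_ℝ) +
        ((∫ x, ⟪w t x, viscAdj 𝔸 (FunctionSpaces.Torus.fourierTruncate N (Ψ t)) x⟫_ℝ) +
          A * ∫ x, ⟪b t x, FunctionSpaces.Torus.convect (w t) (FunctionSpaces.Torus.fourierTruncate N (Ψ t)) x⟫_ℝ))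
    with hGN
  set G : ℝ → ℝ := fun t =>
    (∫ x, ⟪FunctionSpaces.Torus.timeDeriv Ψ t x, w t x⟫_ℝ) +
      ((∫ x, ⟪w t x, FunctionSpaces.Torus.convect (b t) (Ψ t) x⟫_ℝ) +
        ((∫ x, ⟪w t x, viscAdj 𝔸 (Ψ t) x⟫_ℝ) + A * ∫ x, ⟪b t x, FunctionSpaces.Torus.convect (w t) (Ψ t) x⟫_ℝ))
    with hGdef
  have hGN_meas : ∀ N, AEStronglyMeasurable (GN N) (volume.restrict (Ioo 0 T)) := fun N => (hG N).1.aestronglyMeasurable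
  -- domination
  have h_le : ∀ N, ∀ᵐ t ∂(volume.restrict (Ioo 0 T)), ‖GN N t‖ ≤ bound t := by
    intro N
    filter_upwards [ae_restrict_mem measurableSet_Ioo, h.ae_integrable_slice, h.ae_memLp_two, hC, hbw_slice]
      with t ht hτ hwt hCt hbwt
    have htI : t ∈ Icc 0 T := Ioo_subset_Icc_self ht
    -- the four pieces
    have p1 : |∑ k ∈ FunctionSpaces.Torus.freqBall N,
        (⟪mFourierCoeff (FunctionSpaces.EuclideanSpace.complexify ∘ FunctionSpaces.Torus.timeDeriv Ψ t) k,
          mFourierCoeff (FunctionSpaces.EuclideanSpace.complexify ∘ w t) k⟫_ℂ).re| ≤ L * Real.sqrt C := by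
      refine (abs_sum_re_inner_mFourierCoeff_le (hΨ.memLp_two_timeDeriv ht) hwt _).trans ?_
      have h1 : Real.sqrt (∫ x, ‖FunctionSpaces.Torus.timeDeriv Ψ t x‖ ^ 2) ≤ L := by
        have hi : ∫ x, ‖FunctionSpaces.Torus.timeDeriv Ψ t x‖ ^ 2 ≤ L ^ 2 := by
          calc ∫ x, ‖FunctionSpaces.Torus.timeDeriv Ψ t x‖ ^ 2 ≤ ∫ _ : UnitAddTorus d, L ^ 2 :=
                integral_mono_of_nonneg (ae_of_all _ fun x => sq_nonneg _) (integrable_const _)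
                  (ae_of_all _ fun x => pow_le_pow_left₀ (norm_nonneg _) (hL t ht x) 2)
            _ = L ^ 2 := by simp
        calc Real.sqrt (∫ x, ‖FunctionSpaces.Torus.timeDeriv Ψ t x‖ ^ 2) ≤ Real.sqrt (L ^ 2) := Real.sqrt_le_sqrt hi
          _ = L := Real.sqrt_sq hL0
      have h2 : Real.sqrt (∫ x, ‖w t x‖ ^ 2) ≤ Real.sqrt C :=
        Real.sqrt_le_sqrt (integral_norm_sq_le_of_lintegral_le₄ hwt.1 hCt)
      exact mul_le_mul h1 h2 (Real.sqrt_nonneg _) hL0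
    have p2 : |∫ x, ⟪w t x, FunctionSpaces.Torus.convect (b t) (FunctionSpaces.Torus.fourierTruncate N (Ψ t)) x⟫_ℝ| ≤
        (Fintype.card d * (M₁ + E₁)) * ∫ x, ‖b t x‖ * ‖w t x‖ :=
      abs_integral_inner_convect_le_of_partialDeriv_le (hsmP N t) (hdP N t htI) hbwt
    have p3 : |∫ x, ⟪w t x, viscAdj 𝔸 (FunctionSpaces.Torus.fourierTruncate N (Ψ t)) x⟫_ℝ| ≤
        (K𝔸 * (M₂ + E₂)) * ∫ x, ‖w t x‖ :=
      abs_integral_inner_viscAdj_le_of_partialDeriv₂_le 𝔸 (hdP₂ N t htI) hτ.1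
    have p4 : |∫ x, ⟪b t x, FunctionSpaces.Torus.convect (w t) (FunctionSpaces.Torus.fourierTruncate N (Ψ t)) x⟫_ℝ| ≤
        (Fintype.card d * (M₁ + E₁)) * ∫ x, ‖b t x‖ * ‖w t x‖ := by
      have hwb : Integrable (fun x => ‖w t x‖ * ‖b t x‖) volume := hbwt.congr (ae_of_all _ fun x => mul_comm _ _)
      have h1 := abs_integral_inner_convect_le_of_partialDeriv_le (v := b t) (c := w t) (hsmP N t) (hdP N t htI) hwb
      have e : ∫ x, ‖w t x‖ * ‖b t x‖ = ∫ x, ‖b t x‖ * ‖w t x‖ := integral_congr_ae (ae_of_all _ fun x => mul_comm _ _)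
      rw [e] at h1
      exact h1
    rw [hGN, hbound, Real.norm_eq_abs]
    dsimp only
    refine (abs_add_le _ _).trans (add_le_add p1 ((abs_add_le _ _).trans (add_le_add p2
      ((abs_add_le _ _).trans (add_le_add p3 ?_)))))
    rw [abs_mul]
    exact mul_le_mul_of_nonneg_left p4 (abs_nonneg _)
  -- pointwise limits
  have h_lim : ∀ᵐ t ∂(volume.restrict (Ioo 0 T)), Tendsto (fun N => GN N t) atTop (𝓝 (G t)) := by
    filter_upwards [ae_restrict_mem measurableSet_Ioo, h.ae_integrable_slice, h.ae_memLp_two, hbw_slice]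
      with t ht hτ hwt hbwt
    have htI : t ∈ Icc 0 T := Ioo_subset_Icc_self ht
    -- (1) Parseval
    have l1 : Tendsto (fun N => ∑ k ∈ FunctionSpaces.Torus.freqBall N,
        (⟪mFourierCoeff (FunctionSpaces.EuclideanSpace.complexify ∘ FunctionSpaces.Torus.timeDeriv Ψ t) k,
          mFourierCoeff (FunctionSpaces.EuclideanSpace.complexify ∘ w t) k⟫_ℂ).re) atTop
        (𝓝 (∫ x, ⟪FunctionSpaces.Torus.timeDeriv Ψ t x, w t x⟫_ℝ)) :=
      (FunctionSpaces.Torus.hasSum_re_inner_mFourierCoeff_complexify (hΨ.memLp_two_timeDeriv ht) hwt).comp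
        FunctionSpaces.Torus.tendsto_freqBall_atTop
    -- (2)–(4) uniform convergence of the derivatives of the truncations
    have l2 : Tendsto (fun N => ∫ x, ⟪w t x, FunctionSpaces.Torus.convect (b t)
        (FunctionSpaces.Torus.fourierTruncate N (Ψ t)) x⟫_ℝ) atTop
        (𝓝 (∫ x, ⟪w t x, FunctionSpaces.Torus.convect (b t) (Ψ t) x⟫_ℝ)) := by
      refine tendsto_sub_nhds_zero_iff.1 (squeeze_zero_norm (fun N => ?_)
        (by simpa using (hε₁0.const_mul (Fintype.card d : ℝ)).mul_const (∫ x, ‖b t x‖ * ‖w t x‖)))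
      rw [Real.norm_eq_abs, abs_sub_comm]
      exact abs_integral_inner_convect_sub_le_of_partialDeriv_le (hΨ.isSmooth_slice t) (hsmP N t)
        (fun j x => hε₁ N t htI j x) hτ.2.1 hbwt
    have l3 : Tendsto (fun N => ∫ x, ⟪w t x, viscAdj 𝔸 (FunctionSpaces.Torus.fourierTruncate N (Ψ t)) x⟫_ℝ) atTop
        (𝓝 (∫ x, ⟪w t x, viscAdj 𝔸 (Ψ t) x⟫_ℝ)) := by
      refine tendsto_sub_nhds_zero_iff.1 (squeeze_zero_norm (fun N => ?_)
        (by simpa using (hε₂0.const_mul K𝔸).mul_const (∫ x, ‖w t x‖)))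
      rw [Real.norm_eq_abs, abs_sub_comm]
      exact abs_integral_inner_viscAdj_sub_le_of_partialDeriv₂_le 𝔸 (hΨ.isSmooth_slice t) (hsmP N t)
        (fun a b' x => hε₂ N t htI a b' x) hτ.1
    have l4 : Tendsto (fun N => ∫ x, ⟪b t x, FunctionSpaces.Torus.convect (w t)
        (FunctionSpaces.Torus.fourierTruncate N (Ψ t)) x⟫_ℝ) atTop
        (𝓝 (∫ x, ⟪b t x, FunctionSpaces.Torus.convect (w t) (Ψ t) x⟫_ℝ)) := by
      have hwb : Integrable (fun x => ‖w t x‖ * ‖b t x‖) volume := hbwt.congr (ae_of_all _ fun x => mul_comm _ _)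
      refine tendsto_sub_nhds_zero_iff.1 (squeeze_zero_norm (fun N => ?_)
        (by simpa using (hε₁0.const_mul (Fintype.card d : ℝ)).mul_const (∫ x, ‖w t x‖ * ‖b t x‖)))
      rw [Real.norm_eq_abs, abs_sub_comm]
      exact abs_integral_inner_convect_sub_le_of_partialDeriv_le (hΨ.isSmooth_slice t) (hsmP N t)
        (fun j x => hε₁ N t htI j x) hτ.2.2 hwb
    rw [hGdef]
    exact l1.add (l2.add (l3.add (l4.const_mul A)))
  -- dominated convergence in `t`, and the limit of the datum sums
  have hDCT := tendsto_integral_of_dominated_convergence bound hGN_meas hbound_int h_le h_lim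
  have hdatum : Tendsto (fun N => -∑ k ∈ FunctionSpaces.Torus.freqBall N,
      (⟪mFourierCoeff (FunctionSpaces.EuclideanSpace.complexify ∘ w₀) k,
        mFourierCoeff (FunctionSpaces.EuclideanSpace.complexify ∘ Ψ 0) k⟫_ℂ).re) atTop
      (𝓝 (-∫ x, ⟪w₀ x, Ψ 0 x⟫_ℝ)) := by
    have hΨ0 : MemLp (Ψ 0) 2 volume :=
      (hΨ.isSmooth_slice 0).continuous.memLp_of_hasCompactSupport (HasCompactSupport.of_compactSpace _)
    exact ((FunctionSpaces.Torus.hasSum_re_inner_mFourierCoeff_complexify hw₀ hΨ0).comp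
      FunctionSpaces.Torus.tendsto_freqBall_atTop).neg
  have heqN : (fun N => ∫ t in Ioo 0 T, GN N t) = fun N => -∑ k ∈ FunctionSpaces.Torus.freqBall N,
      (⟪mFourierCoeff (FunctionSpaces.EuclideanSpace.complexify ∘ w₀) k,
        mFourierCoeff (FunctionSpaces.EuclideanSpace.complexify ∘ Ψ 0) k⟫_ℂ).re := funext fun N => (hG N).2
  rw [heqN] at hDCT
  have hlim_eq : ∫ t in Ioo 0 T, G t = -∫ x, ⟪w₀ x, Ψ 0 x⟫_ℝ := tendsto_nhds_unique hDCT hdatum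
  -- identify the limit integrand with the weak-form integrand
  have hae : ∀ᵐ t ∂(volume.restrict (Ioo 0 T)),
      (∫ x, (⟪w t x, FunctionSpaces.Torus.timeDeriv Ψ t x + FunctionSpaces.Torus.convect (b t) (Ψ t) x +
          viscAdj 𝔸 (Ψ t) x⟫_ℝ + A * ⟪b t x, FunctionSpaces.Torus.convect (w t) (Ψ t) x⟫_ℝ)) = G t := by
    filter_upwards [ae_restrict_mem measurableSet_Ioo, h.ae_integrable_slice] with t ht hτ
    have i1 : Integrable (fun x => ⟪w t x, FunctionSpaces.Torus.timeDeriv Ψ t x⟫_ℝ) volume :=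
      integrable_inner_of_bdd₄ hτ.1 (hΨ.measurable_timeDeriv t).aestronglyMeasurable (hL t ht)
    have i2 : Integrable (fun x => ⟪w t x, FunctionSpaces.Torus.convect (b t) (Ψ t) x⟫_ℝ) volume :=
      integrable_inner_convect₄ hτ.2.1 (hΨ.isSmooth_slice t)
    have i3 : Integrable (fun x => ⟪w t x, viscAdj 𝔸 (Ψ t) x⟫_ℝ) volume :=
      FunctionSpaces.Torus.integrable_inner_of_continuous hτ.1 (isSmooth_viscAdj 𝔸 (hΨ.isSmooth_slice t)).continuous
    have i4 : Integrable (fun x => ⟪b t x, FunctionSpaces.Torus.convect (w t) (Ψ t) x⟫_ℝ) volume :=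
      integrable_inner_convect₄ hτ.2.2 (hΨ.isSmooth_slice t)
    have e : ∀ x, ⟪w t x, FunctionSpaces.Torus.timeDeriv Ψ t x + FunctionSpaces.Torus.convect (b t) (Ψ t) x +
          viscAdj 𝔸 (Ψ t) x⟫_ℝ + A * ⟪b t x, FunctionSpaces.Torus.convect (w t) (Ψ t) x⟫_ℝ =
        ⟪FunctionSpaces.Torus.timeDeriv Ψ t x, w t x⟫_ℝ + (⟪w t x, FunctionSpaces.Torus.convect (b t) (Ψ t) x⟫_ℝ +
          (⟪w t x, viscAdj 𝔸 (Ψ t) x⟫_ℝ + A * ⟪b t x, FunctionSpaces.Torus.convect (w t) (Ψ t) x⟫_ℝ)) := by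
      intro x
      rw [inner_add_right, inner_add_right, real_inner_comm (w t x) (FunctionSpaces.Torus.timeDeriv Ψ t x)]
      ring
    have i1' : Integrable (fun x => ⟪FunctionSpaces.Torus.timeDeriv Ψ t x, w t x⟫_ℝ) volume :=
      i1.congr (ae_of_all _ fun x => real_inner_comm _ _)
    have i4' : Integrable (fun x => A * ⟪b t x, FunctionSpaces.Torus.convect (w t) (Ψ t) x⟫_ℝ) volume := i4.const_mul A
    have i34 : Integrable (fun x => ⟪w t x, viscAdj 𝔸 (Ψ t) x⟫_ℝ +
        A * ⟪b t x, FunctionSpaces.Torus.convect (w t) (Ψ t) x⟫_ℝ) volume := i3.add i4'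
    have i234 : Integrable (fun x => ⟪w t x, FunctionSpaces.Torus.convect (b t) (Ψ t) x⟫_ℝ +
        (⟪w t x, viscAdj 𝔸 (Ψ t) x⟫_ℝ + A * ⟪b t x, FunctionSpaces.Torus.convect (w t) (Ψ t) x⟫_ℝ)) volume := i2.add i34
    simp_rw [e]
    rw [integral_add i1' i234, integral_add i2 i34, integral_add i3 i4', MeasureTheory.integral_const_mul]
  rw [integral_congr_ae hae, hlim_eq]
  ring

/-- **Converse bridge**: a flat weak solution with `L²` datum is a distorted one with `G ≡ 1`
(the distorted class tests exactly the time-Lipschitz fields, and `𝔸^1 = 𝔸`, `1·v = v`).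
[cite: DiPernaLions1989, §II.1 (13)–(14)] -/
theorem toDistorted_one (h : IsWeakTensorPassiveVectorOn A T 𝔸 b w₀ w) (hw₀ : MemLp w₀ 2 volume) :
    IsWeakTensorPassiveVectorDistortedOn A T 𝔸 b (fun _ _ => (1 : Matrix d d ℝ)) w₀ w where
  aestronglyMeasurable := h.aestronglyMeasurable
  aestronglyMeasurable_carrier := h.aestronglyMeasurable_carrier
  ae_lintegral_sq_le := h.ae_lintegral_sq_le
  lintegral_carrier_lt_top := h.lintegral_carrier_lt_top
  lintegral_mul_lt_top := h.lintegral_mul_lt_top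
  ae_isWeaklyDivFree_carrier := h.ae_isWeaklyDivFree_carrier
  ae_isWeaklyDivFree_distort := by
    filter_upwards [h.ae_isWeaklyDivFree] with t ht
    simpa [distort_one] using ht
  weak_eq := by
    intro Ψ hΨ hΨdiv
    have hdiv : ∀ t, FunctionSpaces.Torus.IsDivFree (Ψ t) := fun t => by
      have h1 := hΨdiv t
      simp only [distort_one] at h1
      exact h1
    have key := h.weak_eq_of_isLipschitzSpaceTimeTest hw₀ hΨ hdiv
    have e : ∀ t x, viscAdjVar (fun y => Visc4.conj ((fun (_ : ℝ) (_ : UnitAddTorus d) => (1 : Matrix d d ℝ)) t y) 𝔸)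
        (Ψ t) x = viscAdj 𝔸 (Ψ t) x := fun t x => viscAdjVar_conj_one 𝔸 (hΨ.isSmooth_slice t) x
    simp only [e]
    exact key

end IsWeakTensorPassiveVectorOn

end Limit

end Torus

end Literature.Analysis.FluidPDE

end
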